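/-
Copyright: lit-balaban Phase-2 proof seat p34 (gen 21).  Statement-level skeleton of a published paper; no proof claims beyond what the
kernel checks below.
-/
import Literature.MathematicalPhysics.QuantumFieldTheory.BalabanImbrieJaffe1984to88.BIJ88DeltaLocSmallPlaquetteTorusCwt
import Literature.MathematicalPhysics.QuantumFieldTheory.BalabanImbrieJaffe1984to88.BIJ88NeumannPropagatorSmoothNearClose

/-!
# [BalabanImbrieJaffe1988] p. 263 **(2.31) (operator and kernel forms), (2.35), (2.30) and (2.36) FOR EVERY `k`-BLOCK REGION `Ω ⊇ Ω₀` UNDER THE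
# PRINTED LOCAL HYPOTHESIS (2.32)** — the gauge field plaquette-small ONLY on the plaquettes based within `2L^k` of `Ω` (resp. r18's `SmoothOn`
# near `Ω`), for the printed torus localization data (file C-II of the TAKING; file C-I = the (H1.12″) input under the same hypothesis)

T. Bałaban, J. Imbrie, A. Jaffe, *Effective action and cluster properties of the abelian Higgs model*, Commun. Math. Phys. **114** (1988)
257–315 [BalabanImbrieJaffe1988], §2 p. 263 [PDF 7]: *"a straightforward application of the random walk expansion of [6] shows that
|(G_{k,loc}(u)f)(x)| ≦ ce^{−c dist(suppt f,x)}‖f‖_∞, (2.30) |(G_{k,loc}(u)f − G_k(Ω,u)f)(x)| ≦ e^{−cr(e_k)}e^{−c dist(suppt f,x)}‖f‖_∞ (2.31) for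
dist(x, Ω^c) ≧ O(r(e_k)). … We assume that u is smooth in the □_α's entering the sum in (2.27); for (2.31) we assume smoothness throughout the
subset Ω ⊂ T_η. This means that in a neighborhood of each □_α there exists an A, λ such that u = exp[ie_kη(A + ∂λ)] with |∂A|, |∂*A| ≦ O(p(e_k)).
(2.32) … Hence |Δ_{k,loc}(u;x₁,x₂) − Δ_k(Ω,u;x₁,x₂)| ≦ e^{−cr(e_k)}e^{−c|x₁−x₂|} for dist({x₁,x₂},Ω^c) > O(r(e_k)), (2.35) |Δ_{k,loc}(u;x₁,x₂)| ≦
ce^{−|x₁−x₂|}. (2.36)"*; [I] = Commun. Math. Phys. **97** (1985) 299–329 [BalabanImbrieJaffe1985], §7.3 p. 326 [PDF 28]: *"by change of gauge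
u_k can be transformed in a local region Λ into a configuration of the form exp[ie_kηA], where A is smooth and small"*; [6] = T. Bałaban,
*Regularity and decay of lattice Green's functions*, Commun. Math. Phys. **89** (1983) 571–597 [Balaban1983RegularityDecay], Theorem p. 573
(1.10)–(1.12).

statement-level skeleton of published theorems with citation tags; proofs where landed; nothing here is a claim about the Yang–Mills mass gap

PDFs held: `paper:balaban1988-cmp114-bij-abelian-higgs-effective-action` (journal page = PDF page + 256; p. 263 = PDF 7);
`paper:balaban1985-cmp97-bij-higgs-minimizers` (p. 326 = PDF 28); `paper:balaban1983-cmp89-regularity-decay` (p. 573 = PDF 3).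

CITATION HEADER (lean-in-tree rule).  Part of the lit-balaban TYPED SKELETON (HOME `run/shared/lean/pub/lit-balaban/`), PHASE-2 proof seat
p34 gen 21 (unit `lit-balaban-p34-g21`; TAKING line HOME/STATUS.md 2026-08-23T12:07:14Z; free-target protocol G.5-34(d)).  WHAT IS
REPRODUCED: located MEMBERS of rows **C2.Eq2.31** / **C2.Eq2.35** / **C2.Eq2.30** / **C2.Eq2.36** / **C2.Claim@263** (owner r18) in the NEW row
«u smooth NEAR Ω only — the printed (2.32)» of r18's `C2S14-CLOSURE.md` §6 (v1.20: *"the (2.31)/(2.35) CLOSENESS conclusions under (2.32) = OPEN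
(any seat; S–M: p31's `BIJ88DeltaLocClose235General` / p30's `close112` region members re-fed with these local inputs)"* — this file is that
re-feeding: the V cell), and r15's **C1.Eq7.3.1-7.3.2** / **C1.Claim@326** (located, cells only).  It is p31 g22's
`BIJ88DeltaLocSmallPlaquetteRegionCwt` / `…TorusCwt` VERBATIM IN SHAPE with the GLOBAL plaquette hypothesis `∀ p, ‖u(∂p) − 1‖ ≤ θ` replaced by the
printed local one `∀ p, (∃ y ∈ Ω, |y − p.src|_∞ ≤ 2L^k) → ‖u(∂p) − 1‖ ≤ θ` (resp. near the reference box `Ω₀` for (2.30)/(2.36), which involve no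
`Ω`), and with the three [6]-inputs of p31's row-restricted chain supplied under that hypothesis: (H1.10) for `G_k(Ω,u)` and (H1.10″) for every
cube `G_k(□_α,u)`, `□_α ⊆ Ω₀ ⊆ Ω` (both = p34 gen 20's `decay110_smoothNear_region` — a cube is a `k`-block union inside `Ω`, so plaquettes near
`□_α` are near `Ω`), (H1.12″) for `G_k(□_α,u) − G_k(Ω,u)` (= file C-I `close112_smoothNear_hC`), at one set of constants.  No row is restated and no
head changes.  USED BY NAME, never restated: p31's `opClose231_gen` / `close231_kernel_gen` / `close235_gen` / `opDecay230_gen` / `decay236_gen`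
(`BIJ88DeltaLocClose235General`), `smallness_of_threshold` / `rowHyp_ii_deep` / `rows_of_deep` (`BIJ88DeltaLocSmallPlaquetteTorusCwt`); p29's torus
data `cubeFam` / `lamFam` / `labels` / `cubeFam_fits` / `cubeOf_subset` / `rowHyp_i` / `rowHyp_iii` / `cutoff_eq_zero_of_le` / `cutoff_mem_unitInterval` /
`sum_abs_lamT_le_one` / `activeLabels` / `card_subtype_activeLabels_le` / `mem_activeLabels_of_ne_zero_of_deep` (`BIJ88LocWeights227Torus`); r18's
`deepRows` / `mem_deepRows`, `SmoothOn`; p27's `cubeT` / `boxCoord` / `isBlockUnion_cubeT` / `mem_cubeT_iff_val`; gen 15's `gLocT` / `deltaLocT` /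
`deltaRegion`; p13's `cutoff`; p34 gen 20's `decay110_smoothNear_region` / `plaqSmall_near_of_smoothOn`, gen 21's `close112_smoothNear_hC`.
Kind: theorems only (no definition, no `Prop`-valued fact).

WHAT IS PROVED (theorems only; 0 `sorry`; standard axioms).
* §1 **`inputs_smoothNear_region`** — the three inputs of the row-restricted chain for a region `Ω ⊇ Ω₀` at one set of constants, for every
  `U(1)` field plaquette-small NEAR `Ω` ONLY (`(L^{2k}θ)² ≤ 1/500`): (H1.10) for `G_k(Ω,u)` at every row, (H1.10″) for every torus cube
  `G_k(□_α,u)` at every row, (H1.12″) for every `G_k(□_α,u) − G_k(Ω,u)` at the `10L^k`-deep rows of `□_α`.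
* §2 **`opClose231_smoothNear_region_cwt`**, **`close231_smoothNear_region_kernel_cwt`** — (2.31), operator and kernel forms, for every `k`-block
  union `Ω ⊇ Ω₀` at a field plaquette-small NEAR `Ω` only, at every fine row of `Ω₀` of chart depth `≥ R₀ + R` (`R > 10L^k`), p31's brackets;
  **`opDecay230_smoothNear_cwt`** — (2.30) at a field plaquette-small near the reference box `Ω₀` only.
* §3 **`close235_smoothNear_region_cwt`** — (2.35) with `Δ_k(Ω,u)`, same hypothesis; **`decay236_smoothNear_cwt`** — (2.36), near `Ω₀` only.
* §4 **`opClose231_smoothOn_region_cwt`**, **`close231_smoothOn_region_kernel_cwt`**, **`close235_smoothOn_region_cwt`** — (2.31)/(2.35) for regions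
  UNDER THE PRINTED (2.32): r18's `SmoothOn e_k η C 𝓅 X B Pl (cfg u)` with `Pl ⊇` the plaquettes based within `2L^k` of `Ω`, `B ⊇` their bonds,
  threshold `(L^{2k}·e_kη²C𝓅)² ≤ 1/500`.
* §5 (v1.1, append-only) **`opClose231_smoothNear_region_cwt_nonvacuous_local`** — NON-VACUITY BY A FIELD THAT IS NOT PLAQUETTE-SMALL: on the
  torus `(ℤ/2·3^{m+1})²` (`3^m > 100`), `k = 1`, `Ω = Ω₀ = [0,66)²`, row `(32,32)` (p31's geometry), the `U(1)` field `u = e^{iεeA₀}` with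
  `e = π/ε` and `A₀` the indicator of the single bond `⟨(100,100), e₀⟩` has `‖u(∂p₀) − 1‖ = 2` at `p₀ = ⟨(100,100), e₀, e₁⟩` (so p31's GLOBAL
  hypothesis fails at every admissible `θ`) and `‖u(∂p) − 1‖ ≤ 0` on every plaquette based within `2L^k` of `Ω`; all hypotheses of §2 hold and
  its conclusion follows — the local hypothesis (2.32) is strictly weaker than plaquette smallness on `T_η`.  (The flat certificate with
  `u = 1` is p31's `BIJ88DeltaLocSmallPlaquetteRegionCwt.opClose231_smallPlaquette_region_cwt_nonvacuous`, whose statement §2 also yields; it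
  is not restated here — gate rule `dedup.landed`.)
HONEST SCOPE / DIVERGENCE.  (i) The hypothesis is LOCAL as printed, in the tree's currency: plaquette smallness `‖u(∂p) − 1‖ ≤ θ` on the plaquettes
BASED within sup-distance `2L^k` of `Ω` (a vortex in a hole of `Ω`, or anything at all away from `Ω`, is allowed), with p31's block-scale threshold
`(L^{2k}θ)² ≤ 1/500`; (2.32) through `SmoothOn` with the divergence clause `|∂*A|` and the site set unused.  (ii)–(ix) of p31's
`BIJ88DeltaLocSmallPlaquetteTorusCwt` / `…RegionCwt` otherwise verbatim: `2 ≤ d′ = d + 1 ≤ 3`, `L = ℓ + 1` odd `≥ 3`, `1 ≤ k ≤ K`,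
`2(L^k − 1) + 4 < |T^{(0)}|`; p29's ORIGINAL torus cubes `cubeFam` of the reference no-wrap box `Ω₀`, `Ω` = ANY union of `k`-blocks containing `Ω₀`;
rows of `Ω₀` at chart depth `≥ R₀ + R`, `R > 10L^k`, `0 ≤ R₁ < R₀`; `δ₀, c₀` existential from `(d, ℓ, a)`; VALUE members ((2.38)/(2.40)/(2.41) under
the local hypothesis need the (7.3.2) lower bound for `Δ_k(Ω,u)` localised — not here; the D / Hθ / H1θ members are p29/p27's of-inputs lanes).
DIVERGENCE OF METHOD as disclosed in the providers (energy/Agmon/mean-value instead of [6]'s random walk).  Literature + Mathlib only.  Nothing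
here is summit progress, continuum or Clay.  Unit `lit-balaban-p34` (literature-prover-lit-balaban-p34-g21-0), HOME `run/shared/lean/pub/lit-balaban/`,
2026-08-23.
v1.1 (p34 gen 21, 2026-08-23): APPEND-ONLY §5 `opClose231_smoothNear_region_cwt_nonvacuous_local` (+ private kernel `far_coord`) and this
header bullet; §1–§4 untouched.
-/

open scoped BigOperators Matrix ComplexConjugate
open Finset Matrix

namespace Literature.MathematicalPhysics.QuantumFieldTheory.BalabanImbrieJaffe1984to88.BIJ88DeltaLocSmoothNearRegionCwt

open Literature.MathematicalPhysics.QuantumFieldTheory.Balaban1983to89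
open LatticeFieldCalculus (supDist)
open GaugeField (plaqHol)
open BIJ88Sect3Statements (U1 toC cfg starB norm_toC)
open BIJ88Sect2Statements (SmoothOn)
open BIJ85BlockAveragesTorus BIJ85BlockAveragesTorusK
open BIJ88NeumannPropagator227Torus (gBox)
open BIJ88DeltaLoc234Torus (gLocT deltaLocT deltaRegion)
open BIJ88NeumannPropagatorFlatDecayCube (cubeT boxCoord isBlockUnion_cubeT)
open BIJ88Cutoffs21 (cutoff)
open BIJ88LocWeights227Torus
open BIJ88DeltaLocClose235General (opDecay230_gen opClose231_gen close231_kernel_gen close235_gen decay236_gen)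
open BIJ88Close231RegularTorusCwt (deepRows mem_deepRows)
open BIJ88NeumannNoZeroModesTorus (IsBlockUnion)
open BIJ88NeumannPropagatorSmoothNearRegion (decay110_smoothNear_region plaqSmall_near_of_smoothOn)
open BIJ88NeumannPropagatorSmoothNearClose (close112_smoothNear_hC)
open BIJ88DeltaLocSmallPlaquetteTorusCwt (smallness_of_threshold rowHyp_ii_deep rows_of_deep)

noncomputable section

variable {P : Params}

/-! ## §1 The three inputs of the row-restricted chain for a region `Ω ⊇ Ω₀` at a field plaquette-small NEAR `Ω` only, at one set of constants -/

section Inputs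

variable {d : ℕ}

/-- kernel: `e^{−δ'E} ≤ e^{−δE}` for `δ ≤ δ'`, `E ≥ 0`. [folklore] -/
private theorem exp_le_exp_of_rate {δ δ' E : ℝ} (hδ : δ ≤ δ') (hE : 0 ≤ E) : Real.exp (-(δ' * E)) ≤ Real.exp (-(δ * E)) :=
  Real.exp_le_exp.2 (neg_le_neg (mul_le_mul_of_nonneg_right hδ hE))

/-- **THE THREE INPUTS OF THE ROW-RESTRICTED CHAIN FOR A REGION `Ω ⊇ Ω₀` AT A FIELD PLAQUETTE-SMALL NEAR `Ω` ONLY, AT ONE SET OF CONSTANTS, FOR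
THE TORUS CUBES OF RECORD** (p. 263: *"for (2.31) we assume smoothness throughout the subset Ω ⊂ T_η"*; [I] p. 326: *"by change of gauge u_k can be
transformed in a local region Λ"*).  For `2 ≤ d′ = d + 1 ≤ 3`, `L = ℓ + 1` odd, `a > 0`: there are `δ₀, c₀ > 0` (depending on `(d, ℓ, a)` only) such
that on every torus of the series, at every level `1 ≤ k ≤ K` with `2(L^k − 1) + 4 < |T^{(0)}|`, for every reference no-wrap box
`Ω₀ = c·L^k + Π_i[0, L^kM₀_i)` (`M₀_i ≥ 1`, shorter than the torus), every spacing/half-width `(s, W)`, every `k`-block union `Ω ⊇ Ω₀` and every `U(1)`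
field `u` with `‖u(∂p) − 1‖ ≤ θ` FOR THE PLAQUETTES BASED WITHIN `2L^k` OF `Ω` (nothing assumed elsewhere), `0 ≤ θ`, `(L^{2k}θ)² ≤ 1/500`:  (H1.10)
for `G_k(Ω,u)` at EVERY row and (H1.10″) for every torus cube `□_α ⊆ Ω₀` at every row (both p34 gen 20's `decay110_smoothNear_region` — the cube is
a `k`-block union inside `Ω`), (H1.12″) for every `□_α` against `Ω` at its `10L^k`-deep rows (file C-I's `close112_smoothNear_hC` fed with the first
two) — common constants `c₀ = max`, `δ₀ = min`.
[cite: BalabanImbrieJaffe1988, (2.31)–(2.32) p.263] [cite: BalabanImbrieJaffe1985, p.326] [cite: Balaban1983RegularityDecay, Theorem p.573 (1.10), (1.11)–(1.12)] -/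
theorem inputs_smoothNear_region (d ℓ : ℕ) (hd1 : 1 ≤ d) (hd3 : d + 1 ≤ 3) (hℓ : 1 ≤ ℓ) (hodd : Odd (ℓ + 1)) {a : ℝ} (ha : 0 < a) :
    ∃ δ₀ c₀ : ℝ, 0 < δ₀ ∧ 0 < c₀ ∧ ∀ (P : Params) (hPd : P.d = d + 1), P.L = ℓ + 1 →
      ∀ {k : ℕ}, 1 ≤ k → k ≤ P.K → 2 * (P.L ^ k - 1) + 4 < P.sitesPerDir 0 →
      ∀ {c M0 : Fin (d + 1) → ℕ}, (∀ i, 1 ≤ M0 i) → (∀ i, c i * P.L ^ k + P.L ^ k * M0 i ≤ P.sitesPerDir 0) →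
        (∀ i, P.L ^ k * M0 i < P.sitesPerDir 0) → ∀ (s W : ℕ) (Ω : Finset (Balaban1983to89.Site P 0)), IsBlockUnion k Ω →
        (cubeT hPd (P.L ^ k) c fun i => P.L ^ k * M0 i) ⊆ Ω →
      ∀ (U : GaugeField P 0 U1) {θ : ℝ}, 0 ≤ θ →
        (∀ p : Balaban1983to89.Plaq P 0, (∃ y ∈ Ω, supDist y p.src ≤ 2 * P.L ^ k) → ‖toC (plaqHol U p) - 1‖ ≤ θ) →
        (((P.L : ℝ) ^ k) ^ 2 * θ) ^ 2 ≤ 1 / 500 →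
      (∀ x ∈ (univ : Finset (Balaban1983to89.Site P 0)), ∀ (f : Balaban1983to89.Site P 0 → ℂ) (F Ds : ℝ), (∀ y, ‖f y‖ ≤ F) → 0 ≤ Ds →
          (∀ y, f y ≠ 0 → Ds ≤ B5Ineq137Torus.T P 0 x y) →
          ‖(gBox (B1RG242Torus.α P a k * (P.L : ℝ) ^ (k * P.d)) P.eps⁻¹ U k Ω *ᵥ f) x‖ ≤
            P.spacing k ^ 2 * (c₀ * Real.exp (-(δ₀ * (((P.L : ℝ) ^ k)⁻¹ * Ds))) * F)) ∧
      (∀ (α : ↥(labels (P.L ^ k) M0 s)), ∀ x ∈ (univ : Finset (Balaban1983to89.Site P 0)),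
        ∀ (f : Balaban1983to89.Site P 0 → ℂ) (F Ds : ℝ), (∀ y, ‖f y‖ ≤ F) → 0 ≤ Ds → (∀ y, f y ≠ 0 → Ds ≤ B5Ineq137Torus.T P 0 x y) →
          ‖(gBox (B1RG242Torus.α P a k * (P.L : ℝ) ^ (k * P.d)) P.eps⁻¹ U k (cubeFam hPd (P.L ^ k) c M0 s W α) *ᵥ f) x‖ ≤
            P.spacing k ^ 2 * (c₀ * Real.exp (-(δ₀ * (((P.L : ℝ) ^ k)⁻¹ * Ds))) * F)) ∧
      (∀ (α : ↥(labels (P.L ^ k) M0 s)), ∀ x ∈ deepRows (10 * (P.L : ℝ) ^ k) (cubeFam hPd (P.L ^ k) c M0 s W α),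
        ∀ (f : Balaban1983to89.Site P 0 → ℂ) (F Ds Db Df : ℝ), (∀ y, ‖f y‖ ≤ F) → (∀ y, y ∉ cubeFam hPd (P.L ^ k) c M0 s W α → f y = 0) →
          0 ≤ Ds → (∀ y, f y ≠ 0 → Ds ≤ B5Ineq137Torus.T P 0 x y) → 0 ≤ Db →
          (∀ w, w ∉ cubeFam hPd (P.L ^ k) c M0 s W α → Db ≤ B5Ineq137Torus.T P 0 x w) → 0 ≤ Df →
          (∀ y, f y ≠ 0 → ∀ w, w ∉ cubeFam hPd (P.L ^ k) c M0 s W α → Df ≤ B5Ineq137Torus.T P 0 y w) →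
          ‖(gBox (B1RG242Torus.α P a k * (P.L : ℝ) ^ (k * P.d)) P.eps⁻¹ U k (cubeFam hPd (P.L ^ k) c M0 s W α) *ᵥ f) x -
              (gBox (B1RG242Torus.α P a k * (P.L : ℝ) ^ (k * P.d)) P.eps⁻¹ U k Ω *ᵥ f) x‖ ≤
            P.spacing k ^ 2 * (c₀ * Real.exp (-(δ₀ * (((P.L : ℝ) ^ k)⁻¹ * Ds))) *
              Real.exp (-(δ₀ * (((P.L : ℝ) ^ k)⁻¹ * (Db + Df)))) * F)) := by
  obtain ⟨δa, ca, hδa, hca, HA⟩ := decay110_smoothNear_region d ℓ hd3 hℓ ha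
  obtain ⟨c₁, δ₁, hc₁, hδ₁, HC⟩ :=
    close112_smoothNear_hC (d + 1) (ℓ + 1) (by omega) hd3 ⟨hodd, by omega⟩ ha hca.le hδa
  refine ⟨min δa δ₁, max ca c₁, lt_min hδa hδ₁, lt_max_of_lt_left hca, ?_⟩
  intro P hPd hPL k hk1 hkK hbig c M0 hM0 hfit0 hN0 s W Ω hΩ hΩ₀ U θ hθ0 hplaq hτ
  have hkm : k ≤ P.m + P.K := hkK.trans (Nat.le_add_left _ _)
  have hLr : (1 : ℝ) ≤ (P.L : ℝ) ^ k := one_le_pow₀ (B1RG242Torus.one_lt_cast_L P).le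
  have hPk : (0 : ℝ) < (P.L : ℝ) ^ k := pow_pos P.cast_L_pos k
  have hdr : (P.d : ℝ) = (d : ℝ) + 1 := by rw [hPd]; push_cast; ring
  have hd1r : (1 : ℝ) ≤ P.d := by rw [hdr]; linarith [(Nat.cast_nonneg d : (0 : ℝ) ≤ d)]
  have hd3r : (P.d : ℝ) ≤ 3 := by rw [hPd]; exact_mod_cast hd3
  obtain ⟨hsm1, hsm2⟩ := smallness_of_threshold hd1r hd3r hLr hθ0 hτ
  have hsk2 : 0 ≤ P.spacing k ^ 2 := sq_nonneg _
  have hT : ((P.d - 1 : ℕ) : ℝ) * ((P.L : ℝ) ^ k - 1) * θ ≤ ((P.d : ℝ) - 1) * ((P.L : ℝ) ^ k - 1) * θ := by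
    have e : ((P.d - 1 : ℕ) : ℝ) = (P.d : ℝ) - 1 := by
      rw [Nat.cast_sub P.hd, Nat.cast_one]
    rw [e]
  -- the cubes: `k`-block unions inside `Ω₀ ⊆ Ω`; plaquettes near a cube are near `Ω`
  have hsub : ∀ α : ↥(labels (P.L ^ k) M0 s), cubeFam hPd (P.L ^ k) c M0 s W α ⊆ Ω := fun α =>
    (cubeOf_subset (hPd := hPd) (n := P.L ^ k) (c := c) (M0 := M0) (s := s) (W := W) α.1).trans hΩ₀
  have hcubeBU : ∀ α : ↥(labels (P.L ^ k) M0 s), IsBlockUnion k (cubeFam hPd (P.L ^ k) c M0 s W α) := fun α => by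
    obtain ⟨c', M, hM, hfit', -, e⟩ := cubeFam_fits (hPd := hPd) (s := s) (W := W) hM0 hfit0 hN0 α
    rw [e]; exact isBlockUnion_cubeT hPd hkm rfl hfit'
  have hplaqα : ∀ α : ↥(labels (P.L ^ k) M0 s), ∀ p : Balaban1983to89.Plaq P 0,
      (∃ y ∈ cubeFam hPd (P.L ^ k) c M0 s W α, supDist y p.src ≤ 2 * P.L ^ k) → ‖toC (plaqHol U p) - 1‖ ≤ θ :=
    fun α p ⟨y, hy, hyp⟩ => hplaq p ⟨y, hsub α hy, hyp⟩
  -- (H1.10) for the region at every row, at `(ca, δa)`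
  have IA : ∀ (x : Balaban1983to89.Site P 0) (f : Balaban1983to89.Site P 0 → ℂ) (F Ds : ℝ), (∀ y, ‖f y‖ ≤ F) →
      (∀ y, f y ≠ 0 → Ds ≤ B5Ineq137Torus.T P 0 x y) →
      ‖(gBox (B1RG242Torus.α P a k * (P.L : ℝ) ^ (k * P.d)) P.eps⁻¹ U k Ω *ᵥ f) x‖ ≤
        P.spacing k ^ 2 * (ca * Real.exp (-(δa * (((P.L : ℝ) ^ k)⁻¹ * Ds))) * F) :=
    fun x f F Ds hF hsupp => HA P hPd hPL k hk1 hkm hbig Ω hΩ U θ hθ0 hplaq _ hT hsm2 x f F Ds hF hsupp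
  -- (H1.10″) for every torus cube at every row, at `(ca, δa)` (the same member, the cube being a block union near which `u` is small)
  have IB : ∀ (α : ↥(labels (P.L ^ k) M0 s)) (x : Balaban1983to89.Site P 0) (f : Balaban1983to89.Site P 0 → ℂ) (F Ds : ℝ),
      (∀ y, ‖f y‖ ≤ F) → (∀ y, f y ≠ 0 → Ds ≤ B5Ineq137Torus.T P 0 x y) →
      ‖(gBox (B1RG242Torus.α P a k * (P.L : ℝ) ^ (k * P.d)) P.eps⁻¹ U k (cubeFam hPd (P.L ^ k) c M0 s W α) *ᵥ f) x‖ ≤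
        P.spacing k ^ 2 * (ca * Real.exp (-(δa * (((P.L : ℝ) ^ k)⁻¹ * Ds))) * F) :=
    fun α x f F Ds hF hsupp => HA P hPd hPL k hk1 hkm hbig _ (hcubeBU α) U θ hθ0 (hplaqα α) _ hT hsm2 x f F Ds hF hsupp
  -- the common constants
  have hδa' : min δa δ₁ ≤ δa := min_le_left _ _
  have hδ1' : min δa δ₁ ≤ δ₁ := min_le_right _ _
  have hca' : ca ≤ max ca c₁ := le_max_left _ _
  have hc1' : c₁ ≤ max ca c₁ := le_max_right _ _
  -- the deep rows of the cubes
  have hXr : ∀ α : ↥(labels (P.L ^ k) M0 s), ∀ x ∈ deepRows (10 * (P.L : ℝ) ^ k) (cubeFam hPd (P.L ^ k) c M0 s W α),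
      x ∈ cubeFam hPd (P.L ^ k) c M0 s W α ∧
        ∀ w, w ∉ cubeFam hPd (P.L ^ k) c M0 s W α → 10 * (P.L : ℝ) ^ k ≤ B5Ineq137Torus.T P 0 x w := by
    intro α x hx
    have h := mem_deepRows.1 hx
    refine ⟨h x (by rw [B5Ineq137Torus.T_self P 0 x]; positivity), fun w hw => ?_⟩
    by_contra hlt
    exact hw (h w (le_of_lt (lt_of_not_ge hlt)))
  -- the two (H1.10″) members with the binder `0 ≤ D`, fed to file C-I's (H1.12″) member
  have IB' : ∀ (α : ↥(labels (P.L ^ k) M0 s)), ∀ x ∈ cubeFam hPd (P.L ^ k) c M0 s W α, ∀ (f : Balaban1983to89.Site P 0 → ℂ)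
      (F Ds : ℝ), (∀ y, ‖f y‖ ≤ F) → 0 ≤ Ds → (∀ y, f y ≠ 0 → Ds ≤ B5Ineq137Torus.T P 0 x y) →
      ‖(gBox (B1RG242Torus.α P a k * (P.L : ℝ) ^ (k * P.d)) P.eps⁻¹ U k (cubeFam hPd (P.L ^ k) c M0 s W α) *ᵥ f) x‖ ≤
        P.spacing k ^ 2 * (ca * Real.exp (-(δa * (((P.L : ℝ) ^ k)⁻¹ * Ds))) * F) :=
    fun α x _ f F Ds hF _ hsupp => IB α x f F Ds hF hsupp
  have IA' : ∀ (α : ↥(labels (P.L ^ k) M0 s)), ∀ x ∈ cubeFam hPd (P.L ^ k) c M0 s W α, ∀ (f : Balaban1983to89.Site P 0 → ℂ)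
      (F Ds : ℝ), (∀ y, ‖f y‖ ≤ F) → 0 ≤ Ds → (∀ y, f y ≠ 0 → Ds ≤ B5Ineq137Torus.T P 0 x y) →
      ‖(gBox (B1RG242Torus.α P a k * (P.L : ℝ) ^ (k * P.d)) P.eps⁻¹ U k Ω *ᵥ f) x‖ ≤
        P.spacing k ^ 2 * (ca * Real.exp (-(δa * (((P.L : ℝ) ^ k)⁻¹ * Ds))) * F) :=
    fun α x _ f F Ds hF _ hsupp => IA x f F Ds hF hsupp
  refine ⟨?_, ?_, ?_⟩
  · -- (H1.10) for the region, every row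
    intro x _ f F Ds hF hDs hsupp
    have hF0 : 0 ≤ F := (norm_nonneg _).trans (hF x)
    refine (IA x f F Ds hF hsupp).trans (mul_le_mul_of_nonneg_left ?_ hsk2)
    exact mul_le_mul_of_nonneg_right (mul_le_mul hca' (exp_le_exp_of_rate hδa' (mul_nonneg (inv_pos.2 hPk).le hDs))
      (Real.exp_pos _).le (hca.le.trans hca')) hF0
  · -- (H1.10″) for the torus cubes at every row
    intro α x _ f F Ds hF hDs hsupp
    have hF0 : 0 ≤ F := (norm_nonneg _).trans (hF x)
    refine (IB α x f F Ds hF hsupp).trans (mul_le_mul_of_nonneg_left ?_ hsk2)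
    exact mul_le_mul_of_nonneg_right (mul_le_mul hca' (exp_le_exp_of_rate hδa' (mul_nonneg (inv_pos.2 hPk).le hDs))
      (Real.exp_pos _).le (hca.le.trans hca')) hF0
  · -- (H1.12″) for the torus cubes against the region, at their `10L^k`-deep rows (file C-I)
    intro α x hx f F Ds Db Df hF hfB hDs hsupp hDb hsDb hDf hsDf
    have hF0 : 0 ≤ F := (norm_nonneg _).trans (hF x)
    have h := HC P hPd hPL k hk1 hkK U Ω θ hθ0 hplaq hsm1 _ hT hsm2 (cubeFam hPd (P.L ^ k) c M0 s W)
      (fun α => deepRows (10 * (P.L : ℝ) ^ k) (cubeFam hPd (P.L ^ k) c M0 s W α)) hΩ hcubeBU hsub hXr IB' IA'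
      α x hx f F Ds Db Df hF hfB hDs hsupp hDb hsDb hDf hsDf
    refine h.trans (mul_le_mul_of_nonneg_left ?_ hsk2)
    refine mul_le_mul_of_nonneg_right ?_ hF0
    exact mul_le_mul (mul_le_mul hc1' (exp_le_exp_of_rate hδ1' (mul_nonneg (inv_pos.2 hPk).le hDs)) (Real.exp_pos _).le
      (hc₁.le.trans hc1')) (exp_le_exp_of_rate hδ1' (mul_nonneg (inv_pos.2 hPk).le (add_nonneg hDb hDf))) (Real.exp_pos _).le
      (mul_nonneg (hc₁.le.trans hc1') (Real.exp_pos _).le)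

end Inputs

/-! ## §2 (2.31), operator and kernel forms, for a region `Ω ⊇ Ω₀` at a field plaquette-small near `Ω` only; (2.30) near `Ω₀` only -/

section Members231

variable {d : ℕ}

/-- kernel: a deeper chart margin implies a shallower one (p31's kernel, copied). [folklore] -/
private theorem depth_mono (hPd : P.d = d + 1) {n : ℕ} {c M0 : Fin (d + 1) → ℕ} {D D' : ℝ} (hDD : D ≤ D')
    {x : Balaban1983to89.Site P 0}
    (hdeep : ∀ i, D' ≤ (boxCoord hPd n c x i : ℝ) ∧ (boxCoord hPd n c x i : ℝ) + D' ≤ (n * M0 i : ℕ) - 1) :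
    ∀ i, D ≤ (boxCoord hPd n c x i : ℝ) ∧ (boxCoord hPd n c x i : ℝ) + D ≤ (n * M0 i : ℕ) - 1 :=
  fun i => ⟨hDD.trans (hdeep i).1, by linarith [(hdeep i).2]⟩

/-- kernel: `|ζ″| ≤ 1` for p13's cut-off (p31's kernel, copied). [folklore] -/
private theorem abs_cutoff_le_one (R₁ R₀ : ℝ) (x y : Balaban1983to89.Site P 0) : |cutoff R₁ R₀ (B5Ineq137Torus.T P 0) x y| ≤ 1 :=
  abs_le.2 ⟨by linarith [(cutoff_mem_unitInterval R₁ R₀ x y).1], (cutoff_mem_unitInterval R₁ R₀ x y).2⟩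

/-- **(2.31), OPERATOR FORM, FOR A GENERAL REGION `Ω ⊇ Ω₀` AT A FIELD PLAQUETTE-SMALL NEAR `Ω` ONLY, FOR THE PRINTED TORUS DATA** (p. 263:
*"|(G_{k,loc}(u)f − G_k(Ω,u)f)(x)| ≦ e^{−cr(e_k)}e^{−c dist(suppt f,x)}‖f‖_∞ (2.31) for dist(x, Ω^c) ≧ O(r(e_k)) … for (2.31) we assume smoothness
throughout the subset Ω ⊂ T_η"*, (2.32)).  For `2 ≤ d′ = d + 1 ≤ 3`, `L = ℓ + 1` odd, `a > 0`: `∃ δ₀, c₀ > 0` (from `(d, ℓ, a)` only) such that on every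
torus of the series, at every level `1 ≤ k ≤ K` with `2(L^k − 1) + 4 < |T^{(0)}|`, every reference no-wrap box `Ω₀`, spacing `s_g ≥ 1`, half-width
`W ≥ 2s_g/3 + R₀/2 + R`, radii `R > 10L^k`, `0 ≤ R₁ < R₀`, EVERY union `Ω` of `k`-blocks with `Ω₀ ⊆ Ω`, every `U(1)` field `u` with `‖u(∂p) − 1‖ ≤ θ`
FOR THE PLAQUETTES BASED WITHIN `2L^k` OF `Ω` (`0 ≤ θ`, `(L^{2k}θ)² ≤ 1/500`; nothing assumed elsewhere), every fine row `x ∈ Ω₀` of chart depth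
`≥ R₀ + R`, and every `f` with `‖f‖_∞ ≤ F` supported at sup-torus distance `≥ D ≥ 0` from `x`:
`‖(G_{k,loc}(u)f − G_k(Ω,u)f)(x)‖ ≤ (L^kε)²·c₀·(m·e^{−2δ₀R/L^k} + e^{−(δ₀/2)R₁/L^k})·e^{−(δ₀/2)D/L^k}·F` — p31's `opClose231_gen` BY NAME, inputs §1.
[cite: BalabanImbrieJaffe1988, (2.31)–(2.32) p.263] [cite: BalabanImbrieJaffe1985, p.326] -/
theorem opClose231_smoothNear_region_cwt (d ℓ : ℕ) (hd1 : 1 ≤ d) (hd3 : d + 1 ≤ 3) (hℓ : 1 ≤ ℓ) (hodd : Odd (ℓ + 1)) {a : ℝ} (ha : 0 < a) :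
    ∃ δ₀ c₀ : ℝ, 0 < δ₀ ∧ 0 < c₀ ∧ ∀ (P : Params) (hPd : P.d = d + 1), P.L = ℓ + 1 →
      ∀ (k : ℕ), 1 ≤ k → k ≤ P.K → 2 * (P.L ^ k - 1) + 4 < P.sitesPerDir 0 →
      ∀ (c M0 : Fin (d + 1) → ℕ), (∀ i, 1 ≤ M0 i) → (∀ i, c i * P.L ^ k + P.L ^ k * M0 i ≤ P.sitesPerDir 0) →
        (∀ i, P.L ^ k * M0 i < P.sitesPerDir 0) →
      ∀ (sg W : ℕ), 1 ≤ sg → ∀ (R R₀ R₁ : ℝ), 10 * (P.L : ℝ) ^ k < R → 0 ≤ R₁ → R₁ < R₀ →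
        2 * (sg : ℝ) / 3 + R₀ / 2 + R ≤ W → (∀ i, ((P.L ^ k * M0 i : ℕ) : ℝ) + R ≤ P.sitesPerDir 0) →
      ∀ (Ω : Finset (Balaban1983to89.Site P 0)), IsBlockUnion k Ω → (cubeT hPd (P.L ^ k) c fun i => P.L ^ k * M0 i) ⊆ Ω →
      ∀ (U : GaugeField P 0 U1) (θ : ℝ), 0 ≤ θ →
        (∀ p : Balaban1983to89.Plaq P 0, (∃ y ∈ Ω, supDist y p.src ≤ 2 * P.L ^ k) → ‖toC (plaqHol U p) - 1‖ ≤ θ) →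
        (((P.L : ℝ) ^ k) ^ 2 * θ) ^ 2 ≤ 1 / 500 →
      ∀ (x : Balaban1983to89.Site P 0), x ∈ (cubeT hPd (P.L ^ k) c fun i => P.L ^ k * M0 i) →
        (∀ i, R₀ + R ≤ (boxCoord hPd (P.L ^ k) c x i : ℝ) ∧ (boxCoord hPd (P.L ^ k) c x i : ℝ) + (R₀ + R) ≤ (P.L ^ k * M0 i : ℕ) - 1) →
      ∀ (f : Balaban1983to89.Site P 0 → ℂ) (F D : ℝ), (∀ y, ‖f y‖ ≤ F) → 0 ≤ D → (∀ y, f y ≠ 0 → D ≤ B5Ineq137Torus.T P 0 x y) →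
        ‖(gLocT (B1RG242Torus.α P a k * (P.L : ℝ) ^ (k * P.d)) P.eps⁻¹ U k
              (cubeFam hPd (P.L ^ k) c M0 sg W) (lamFam hPd (P.L ^ k) c M0 sg) (cutoff R₁ R₀ (B5Ineq137Torus.T P 0)) *ᵥ f) x -
            (gBox (B1RG242Torus.α P a k * (P.L : ℝ) ^ (k * P.d)) P.eps⁻¹ U k Ω *ᵥ f) x‖ ≤
          P.spacing k ^ 2 * (c₀ * (((⌊(((P.L : ℝ) ^ k) - 1 + R₀) / sg⌋₊ : ℝ) + 3) ^ (d + 1) *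
              Real.exp (-(δ₀ * (((P.L : ℝ) ^ k)⁻¹ * (2 * R)))) +
                Real.exp (-(δ₀ / 2 * (((P.L : ℝ) ^ k)⁻¹ * R₁)))) *
            Real.exp (-(δ₀ / 2 * (((P.L : ℝ) ^ k)⁻¹ * D))) * F) := by
  obtain ⟨δ₀, c₀, hδ₀, hc₀, I⟩ := inputs_smoothNear_region d ℓ hd1 hd3 hℓ hodd ha
  refine ⟨δ₀, c₀, hδ₀, hc₀, ?_⟩
  intro P hPd hPL k hk1 hkK hbig c M0 hM0 hfit0 hN0 sg W hsg R R₀ R₁ hRm hR₁ hR10 hW hgap Ω hΩ hΩ₀ U θ hθ0 hplaq hτ x hx hdeep f F D hF hD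
    hsupp
  obtain ⟨I1, -, I3⟩ := I P hPd hPL hk1 hkK hbig hM0 hfit0 hN0 sg W Ω hΩ hΩ₀ U hθ0 hplaq hτ
  have hkm : k ≤ P.m + P.K := hkK.trans (Nat.le_add_left _ _)
  have hk : 0 + k ≤ P.m + P.K := by omega
  have hn : 1 ≤ P.L ^ k := Nat.one_le_pow _ _ P.L_pos
  have hPk : (0 : ℝ) < (P.L : ℝ) ^ k := pow_pos P.cast_L_pos k
  have hR : 0 ≤ R := le_trans (by positivity) hRm.le
  have hR₀ : 0 ≤ R₀ := hR₁.trans hR10.le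
  have hζ0 := cutoff_eq_zero_of_le (P := P) hR10
  have hF0 : 0 ≤ F := (norm_nonneg _).trans (hF x)
  have hdeep₀ := depth_mono hPd (show R₀ ≤ R₀ + R by linarith) hdeep
  set S : Finset ↥(labels (P.L ^ k) M0 sg) :=
    (activeLabels hPd (P.L ^ k) c sg R₀ (blkIter k x)).subtype fun α => α ∈ labels (P.L ^ k) M0 sg with hSdef
  have hS : ∀ (α : ↥(labels (P.L ^ k) M0 sg)) (y : Balaban1983to89.Site P 0),
      cutoff R₁ R₀ (B5Ineq137Torus.T P 0) x y * lamFam hPd (P.L ^ k) c M0 sg α x y ≠ 0 → f y ≠ 0 → α ∈ S := by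
    intro α y hne _
    rw [hSdef, Finset.mem_subtype]
    exact mem_activeLabels_of_ne_zero_of_deep hk hsg hfit0 hζ0 (mem_blockK.2 rfl) hdeep₀ hne
  have hB := opClose231_gen (B1RG242Torus.α P a k * (P.L : ℝ) ^ (k * P.d)) P.eps⁻¹ U Ω univ
    (cubeFam hPd (P.L ^ k) c M0 sg W) (fun α => deepRows (10 * (P.L : ℝ) ^ k) (cubeFam hPd (P.L ^ k) c M0 sg W α))
    (lam := lamFam hPd (P.L ^ k) c M0 sg) (ζ'' := cutoff R₁ R₀ (B5Ineq137Torus.T P 0))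
    (sum_abs_lamT_le_one hfit0) (cutoff_mem_unitInterval R₁ R₀) hδ₀.le hc₀.le I1 I3
    x (mem_univ x) hR (rowHyp_i hPd hfit0 hζ0 hx hdeep₀)
    (rowHyp_ii_deep hPd hn hsg hfit0 hR hR₀ hRm hgap hW hζ0 hx hdeep) (rowHyp_iii hR10 x) f hF hD hsupp S hS
  refine hB.trans ?_
  have hcard : (S.card : ℝ) ≤ (⌊(((P.L : ℝ) ^ k) - 1 + R₀) / sg⌋₊ + 3) ^ (d + 1) := by
    have h1 := card_subtype_activeLabels_le (hPd := hPd) (c := c) (M0 := M0) hn hsg hR₀ (blkIter k x)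
    have e1 : (((P.L ^ k : ℕ) : ℕ) : ℝ) = (P.L : ℝ) ^ k := by push_cast; rfl
    rw [hSdef]
    rw [e1] at h1
    exact h1
  have hE1 := (Real.exp_pos (-(δ₀ * (((P.L : ℝ) ^ k)⁻¹ * (2 * R))))).le
  have hE2 := (Real.exp_pos (-(δ₀ / 2 * (((P.L : ℝ) ^ k)⁻¹ * D)))).le
  refine mul_le_mul_of_nonneg_left ?_ (sq_nonneg _)
  refine mul_le_mul_of_nonneg_right (mul_le_mul_of_nonneg_right (mul_le_mul_of_nonneg_left ?_ hc₀.le) hE2) hF0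
  exact add_le_add (mul_le_mul_of_nonneg_right hcard hE1) le_rfl

/-- **(2.31), KERNEL FORM, FOR A GENERAL REGION `Ω ⊇ Ω₀` AT A FIELD PLAQUETTE-SMALL NEAR `Ω` ONLY, FOR THE PRINTED TORUS DATA**: with the data and
hypotheses of `opClose231_smoothNear_region_cwt`, for every fine row `x ∈ Ω₀` of chart depth `≥ R₀ + R` and EVERY `y ∈ T^{(0)}`:
`‖G_{k,loc}(u; x, y) − G_k(Ω, u; x, y)‖ ≤ (L^kε)²·c₀·(e^{−2δ₀R/L^k} + e^{−(δ₀/2)R₁/L^k})·e^{−(δ₀/2)|x−y|_T/L^k}` — p31's `close231_kernel_gen` BY NAME.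
[cite: BalabanImbrieJaffe1988, (2.31)–(2.32) p.263] -/
theorem close231_smoothNear_region_kernel_cwt (d ℓ : ℕ) (hd1 : 1 ≤ d) (hd3 : d + 1 ≤ 3) (hℓ : 1 ≤ ℓ) (hodd : Odd (ℓ + 1)) {a : ℝ}
    (ha : 0 < a) :
    ∃ δ₀ c₀ : ℝ, 0 < δ₀ ∧ 0 < c₀ ∧ ∀ (P : Params) (hPd : P.d = d + 1), P.L = ℓ + 1 →
      ∀ (k : ℕ), 1 ≤ k → k ≤ P.K → 2 * (P.L ^ k - 1) + 4 < P.sitesPerDir 0 →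
      ∀ (c M0 : Fin (d + 1) → ℕ), (∀ i, 1 ≤ M0 i) → (∀ i, c i * P.L ^ k + P.L ^ k * M0 i ≤ P.sitesPerDir 0) →
        (∀ i, P.L ^ k * M0 i < P.sitesPerDir 0) →
      ∀ (sg W : ℕ), 1 ≤ sg → ∀ (R R₀ R₁ : ℝ), 10 * (P.L : ℝ) ^ k < R → 0 ≤ R₁ → R₁ < R₀ →
        2 * (sg : ℝ) / 3 + R₀ / 2 + R ≤ W → (∀ i, ((P.L ^ k * M0 i : ℕ) : ℝ) + R ≤ P.sitesPerDir 0) →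
      ∀ (Ω : Finset (Balaban1983to89.Site P 0)), IsBlockUnion k Ω → (cubeT hPd (P.L ^ k) c fun i => P.L ^ k * M0 i) ⊆ Ω →
      ∀ (U : GaugeField P 0 U1) (θ : ℝ), 0 ≤ θ →
        (∀ p : Balaban1983to89.Plaq P 0, (∃ y ∈ Ω, supDist y p.src ≤ 2 * P.L ^ k) → ‖toC (plaqHol U p) - 1‖ ≤ θ) →
        (((P.L : ℝ) ^ k) ^ 2 * θ) ^ 2 ≤ 1 / 500 →
      ∀ (x : Balaban1983to89.Site P 0), x ∈ (cubeT hPd (P.L ^ k) c fun i => P.L ^ k * M0 i) →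
        (∀ i, R₀ + R ≤ (boxCoord hPd (P.L ^ k) c x i : ℝ) ∧ (boxCoord hPd (P.L ^ k) c x i : ℝ) + (R₀ + R) ≤ (P.L ^ k * M0 i : ℕ) - 1) →
      ∀ y : Balaban1983to89.Site P 0,
        ‖gLocT (B1RG242Torus.α P a k * (P.L : ℝ) ^ (k * P.d)) P.eps⁻¹ U k
              (cubeFam hPd (P.L ^ k) c M0 sg W) (lamFam hPd (P.L ^ k) c M0 sg) (cutoff R₁ R₀ (B5Ineq137Torus.T P 0)) x y -
            gBox (B1RG242Torus.α P a k * (P.L : ℝ) ^ (k * P.d)) P.eps⁻¹ U k Ω x y‖ ≤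
          P.spacing k ^ 2 * (c₀ * (Real.exp (-(δ₀ * (((P.L : ℝ) ^ k)⁻¹ * (2 * R)))) +
              Real.exp (-(δ₀ / 2 * (((P.L : ℝ) ^ k)⁻¹ * R₁)))) *
            Real.exp (-(δ₀ / 2 * (((P.L : ℝ) ^ k)⁻¹ * B5Ineq137Torus.T P 0 x y)))) := by
  obtain ⟨δ₀, c₀, hδ₀, hc₀, I⟩ := inputs_smoothNear_region d ℓ hd1 hd3 hℓ hodd ha
  refine ⟨δ₀, c₀, hδ₀, hc₀, ?_⟩
  intro P hPd hPL k hk1 hkK hbig c M0 hM0 hfit0 hN0 sg W hsg R R₀ R₁ hRm hR₁ hR10 hW hgap Ω hΩ hΩ₀ U θ hθ0 hplaq hτ x hx hdeep y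
  obtain ⟨I1, -, I3⟩ := I P hPd hPL hk1 hkK hbig hM0 hfit0 hN0 sg W Ω hΩ hΩ₀ U hθ0 hplaq hτ
  have hkm : k ≤ P.m + P.K := hkK.trans (Nat.le_add_left _ _)
  have hk : 0 + k ≤ P.m + P.K := by omega
  have hn : 1 ≤ P.L ^ k := Nat.one_le_pow _ _ P.L_pos
  have hPk : (0 : ℝ) < (P.L : ℝ) ^ k := pow_pos P.cast_L_pos k
  have hR : 0 ≤ R := le_trans (by positivity) hRm.le
  have hR₀ : 0 ≤ R₀ := hR₁.trans hR10.le
  have hζ0 := cutoff_eq_zero_of_le (P := P) hR10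
  have hdeep₀ := depth_mono hPd (show R₀ ≤ R₀ + R by linarith) hdeep
  exact close231_kernel_gen (B1RG242Torus.α P a k * (P.L : ℝ) ^ (k * P.d)) P.eps⁻¹ U Ω univ
    (cubeFam hPd (P.L ^ k) c M0 sg W) (fun α => deepRows (10 * (P.L : ℝ) ^ k) (cubeFam hPd (P.L ^ k) c M0 sg W α))
    (lam := lamFam hPd (P.L ^ k) c M0 sg) (ζ'' := cutoff R₁ R₀ (B5Ineq137Torus.T P 0))
    (sum_abs_lamT_le_one hfit0) (cutoff_mem_unitInterval R₁ R₀) hδ₀.le hc₀.le I1 I3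
    x (mem_univ x) hR (rowHyp_i hPd hfit0 hζ0 hx hdeep₀)
    (rowHyp_ii_deep hPd hn hsg hfit0 hR hR₀ hRm hgap hW hζ0 hx hdeep) (rowHyp_iii hR10 x) y

/-- **(2.30) FOR `G_{k,loc}(u)` AT A FIELD PLAQUETTE-SMALL NEAR THE REFERENCE BOX `Ω₀` ONLY, FOR THE PRINTED TORUS DATA** (p. 263:
*"|(G_{k,loc}(u)f)(x)| ≦ ce^{−c dist(suppt f,x)}‖f‖_∞, (2.30) … We assume that u is smooth in the □_α's entering the sum in (2.27)"*): with the
box data of `opClose231_smoothNear_region_cwt`, for every `U(1)` field `u` with `‖u(∂p) − 1‖ ≤ θ` for the plaquettes based within `2L^k` of `Ω₀`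
(every `□_α ⊆ Ω₀`), every fine row `x ∈ Ω₀` of chart depth `≥ R₀ + R` and every `f` with `‖f‖_∞ ≤ F` supported at sup-torus distance `≥ D ≥ 0`:
`‖(G_{k,loc}(u)f)(x)‖ ≤ (L^kε)²·m·c₀·e^{−δ₀D/L^k}·F` — p31's `opDecay230_gen` BY NAME with the (H1.10″) cube inputs of §1 at `Ω = Ω₀`.
[cite: BalabanImbrieJaffe1988, (2.30), (2.32) p.263] -/
theorem opDecay230_smoothNear_cwt (d ℓ : ℕ) (hd1 : 1 ≤ d) (hd3 : d + 1 ≤ 3) (hℓ : 1 ≤ ℓ) (hodd : Odd (ℓ + 1)) {a : ℝ} (ha : 0 < a) :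
    ∃ δ₀ c₀ : ℝ, 0 < δ₀ ∧ 0 < c₀ ∧ ∀ (P : Params) (hPd : P.d = d + 1), P.L = ℓ + 1 →
      ∀ (k : ℕ), 1 ≤ k → k ≤ P.K → 2 * (P.L ^ k - 1) + 4 < P.sitesPerDir 0 →
      ∀ (c M0 : Fin (d + 1) → ℕ), (∀ i, 1 ≤ M0 i) → (∀ i, c i * P.L ^ k + P.L ^ k * M0 i ≤ P.sitesPerDir 0) →
        (∀ i, P.L ^ k * M0 i < P.sitesPerDir 0) →
      ∀ (sg W : ℕ), 1 ≤ sg → ∀ (R R₀ R₁ : ℝ), 10 * (P.L : ℝ) ^ k < R → 0 ≤ R₁ → R₁ < R₀ →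
        2 * (sg : ℝ) / 3 + R₀ / 2 + R ≤ W → (∀ i, ((P.L ^ k * M0 i : ℕ) : ℝ) + R ≤ P.sitesPerDir 0) →
      ∀ (U : GaugeField P 0 U1) (θ : ℝ), 0 ≤ θ →
        (∀ p : Balaban1983to89.Plaq P 0, (∃ y ∈ (cubeT hPd (P.L ^ k) c fun i => P.L ^ k * M0 i), supDist y p.src ≤ 2 * P.L ^ k) →
          ‖toC (plaqHol U p) - 1‖ ≤ θ) →
        (((P.L : ℝ) ^ k) ^ 2 * θ) ^ 2 ≤ 1 / 500 →
      ∀ (x : Balaban1983to89.Site P 0), x ∈ (cubeT hPd (P.L ^ k) c fun i => P.L ^ k * M0 i) →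
        (∀ i, R₀ + R ≤ (boxCoord hPd (P.L ^ k) c x i : ℝ) ∧ (boxCoord hPd (P.L ^ k) c x i : ℝ) + (R₀ + R) ≤ (P.L ^ k * M0 i : ℕ) - 1) →
      ∀ (f : Balaban1983to89.Site P 0 → ℂ) (F D : ℝ), (∀ y, ‖f y‖ ≤ F) → 0 ≤ D → (∀ y, f y ≠ 0 → D ≤ B5Ineq137Torus.T P 0 x y) →
        ‖(gLocT (B1RG242Torus.α P a k * (P.L : ℝ) ^ (k * P.d)) P.eps⁻¹ U k
              (cubeFam hPd (P.L ^ k) c M0 sg W) (lamFam hPd (P.L ^ k) c M0 sg) (cutoff R₁ R₀ (B5Ineq137Torus.T P 0)) *ᵥ f) x‖ ≤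
          P.spacing k ^ 2 * (((⌊(((P.L : ℝ) ^ k) - 1 + R₀) / sg⌋₊ : ℝ) + 3) ^ (d + 1) *
            (c₀ * Real.exp (-(δ₀ * (((P.L : ℝ) ^ k)⁻¹ * D))) * F)) := by
  obtain ⟨δ₀, c₀, hδ₀, hc₀, I⟩ := inputs_smoothNear_region d ℓ hd1 hd3 hℓ hodd ha
  refine ⟨δ₀, c₀, hδ₀, hc₀, ?_⟩
  intro P hPd hPL k hk1 hkK hbig c M0 hM0 hfit0 hN0 sg W hsg R R₀ R₁ hRm hR₁ hR10 hW hgap U θ hθ0 hplaq hτ x hx hdeep f F D hF hD hsupp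
  have hkm : k ≤ P.m + P.K := hkK.trans (Nat.le_add_left _ _)
  have hk : 0 + k ≤ P.m + P.K := by omega
  have hΩ₀ : IsBlockUnion k (cubeT hPd (P.L ^ k) c fun i => P.L ^ k * M0 i) := isBlockUnion_cubeT hPd hkm rfl hfit0
  obtain ⟨-, I2, -⟩ := I P hPd hPL hk1 hkK hbig hM0 hfit0 hN0 sg W _ hΩ₀ subset_rfl U hθ0 hplaq hτ
  have hn : 1 ≤ P.L ^ k := Nat.one_le_pow _ _ P.L_pos
  have hPk : (0 : ℝ) < (P.L : ℝ) ^ k := pow_pos P.cast_L_pos k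
  have hR : 0 ≤ R := le_trans (by positivity) hRm.le
  have hR₀ : 0 ≤ R₀ := hR₁.trans hR10.le
  have hζ0 := cutoff_eq_zero_of_le (P := P) hR10
  have hF0 : 0 ≤ F := (norm_nonneg _).trans (hF x)
  have hdeep₀ := depth_mono hPd (show R₀ ≤ R₀ + R by linarith) hdeep
  set S : Finset ↥(labels (P.L ^ k) M0 sg) :=
    (activeLabels hPd (P.L ^ k) c sg R₀ (blkIter k x)).subtype fun α => α ∈ labels (P.L ^ k) M0 sg with hSdef
  have hS : ∀ (α : ↥(labels (P.L ^ k) M0 sg)) (y : Balaban1983to89.Site P 0),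
      cutoff R₁ R₀ (B5Ineq137Torus.T P 0) x y * lamFam hPd (P.L ^ k) c M0 sg α x y ≠ 0 → f y ≠ 0 → α ∈ S := by
    intro α y hne _
    rw [hSdef, Finset.mem_subtype]
    exact mem_activeLabels_of_ne_zero_of_deep hk hsg hfit0 hζ0 (mem_blockK.2 rfl) hdeep₀ hne
  have hB := opDecay230_gen (k := k) (B1RG242Torus.α P a k * (P.L : ℝ) ^ (k * P.d)) P.eps⁻¹ U
    (cubeFam hPd (P.L ^ k) c M0 sg W) (fun α => deepRows (10 * (P.L : ℝ) ^ k) (cubeFam hPd (P.L ^ k) c M0 sg W α))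
    (lam := lamFam hPd (P.L ^ k) c M0 sg) (ζ'' := cutoff R₁ R₀ (B5Ineq137Torus.T P 0))
    (sum_abs_lamT_le_one hfit0) (abs_cutoff_le_one R₁ R₀) (δ₀ := δ₀) hc₀.le (fun α x hx => I2 α x (mem_univ x))
    x f hF hD hsupp (fun α y hne => (rowHyp_ii_deep hPd hn hsg hfit0 hR hR₀ hRm hgap hW hζ0 hx hdeep α y hne).1) S hS
  refine hB.trans ?_
  have hcard : (S.card : ℝ) ≤ (⌊(((P.L : ℝ) ^ k) - 1 + R₀) / sg⌋₊ + 3) ^ (d + 1) := by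
    have h1 := card_subtype_activeLabels_le (hPd := hPd) (c := c) (M0 := M0) hn hsg hR₀ (blkIter k x)
    have e1 : (((P.L ^ k : ℕ) : ℕ) : ℝ) = (P.L : ℝ) ^ k := by push_cast; rfl
    rw [hSdef]
    rw [e1] at h1
    exact h1
  refine mul_le_mul_of_nonneg_left (mul_le_mul_of_nonneg_right hcard ?_) (sq_nonneg _)
  exact mul_nonneg (mul_nonneg hc₀.le (Real.exp_pos _).le) hF0

end Members231

/-! ## §3 (2.35) for a region `Ω ⊇ Ω₀` and (2.36), at a field plaquette-small near `Ω` (resp. near `Ω₀`) only -/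

section Members235

variable {d : ℕ}

/-- kernel: `|ζ″| ≤ 1` for p13's cut-off (copy for this section). [folklore] -/
private theorem abs_cutoff_le_one₂ (R₁ R₀ : ℝ) (x y : Balaban1983to89.Site P 0) : |cutoff R₁ R₀ (B5Ineq137Torus.T P 0) x y| ≤ 1 :=
  abs_le.2 ⟨by linarith [(cutoff_mem_unitInterval R₁ R₀ x y).1], (cutoff_mem_unitInterval R₁ R₀ x y).2⟩

/-- **(2.35) FOR A GENERAL REGION `Ω ⊇ Ω₀` AT A FIELD PLAQUETTE-SMALL NEAR `Ω` ONLY, FOR THE PRINTED TORUS DATA** (p. 263: *"Hence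
|Δ_{k,loc}(u;x₁,x₂) − Δ_k(Ω,u;x₁,x₂)| ≦ e^{−cr(e_k)}e^{−c|x₁−x₂|} for dist({x₁,x₂},Ω^c) > O(r(e_k)). (2.35)"*, (2.32)): with the data of
`opClose231_smoothNear_region_cwt`, for every union `Ω` of `k`-blocks with `Ω₀ ⊆ Ω`, every `U(1)` field plaquette-small near `Ω` only, every `k`-site
`y₁` whose block lies in `Ω₀` with chart margin `R₀ + R` and every `y₂ ∈ T^{(k)}`:
`‖Δ_{k,loc}(u; y₁, y₂) − Δ_k(Ω,u; y₁, y₂)‖ ≤ A·a_k·c₀e^{δ₀/2}·(m·e^{−2δ₀R/L^k} + e^{−(δ₀/2)R₁/L^k})·e^{−(δ₀/2)|y₁−y₂|_{T^{(k)}}}` — p31's `close235_gen` BY NAME.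
[cite: BalabanImbrieJaffe1988, (2.35), (2.32) p.263] -/
theorem close235_smoothNear_region_cwt (d ℓ : ℕ) (hd1 : 1 ≤ d) (hd3 : d + 1 ≤ 3) (hℓ : 1 ≤ ℓ) (hodd : Odd (ℓ + 1)) {a : ℝ} (ha : 0 < a) :
    ∃ δ₀ c₀ : ℝ, 0 < δ₀ ∧ 0 < c₀ ∧ ∀ (P : Params) (hPd : P.d = d + 1), P.L = ℓ + 1 →
      ∀ (k : ℕ), 1 ≤ k → k ≤ P.K → 2 * (P.L ^ k - 1) + 4 < P.sitesPerDir 0 →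
      ∀ (c M0 : Fin (d + 1) → ℕ), (∀ i, 1 ≤ M0 i) → (∀ i, c i * P.L ^ k + P.L ^ k * M0 i ≤ P.sitesPerDir 0) →
        (∀ i, P.L ^ k * M0 i < P.sitesPerDir 0) →
      ∀ (sg W : ℕ), 1 ≤ sg → ∀ (R R₀ R₁ : ℝ), 10 * (P.L : ℝ) ^ k < R → 0 ≤ R₁ → R₁ < R₀ →
        2 * (sg : ℝ) / 3 + R₀ / 2 + R ≤ W → (∀ i, ((P.L ^ k * M0 i : ℕ) : ℝ) + R ≤ P.sitesPerDir 0) →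
      ∀ (Ω : Finset (Balaban1983to89.Site P 0)), IsBlockUnion k Ω → (cubeT hPd (P.L ^ k) c fun i => P.L ^ k * M0 i) ⊆ Ω →
      ∀ (U : GaugeField P 0 U1) (θ : ℝ), 0 ≤ θ →
        (∀ p : Balaban1983to89.Plaq P 0, (∃ y ∈ Ω, supDist y p.src ≤ 2 * P.L ^ k) → ‖toC (plaqHol U p) - 1‖ ≤ θ) →
        (((P.L : ℝ) ^ k) ^ 2 * θ) ^ 2 ≤ 1 / 500 →
      ∀ (y₁ y₂ : Balaban1983to89.Site P (0 + k)),
        (∀ μ, (c (Fin.cast hPd μ) : ℝ) * P.L ^ k + (R₀ + R) ≤ (P.L : ℝ) ^ k * (y₁ μ).val ∧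
          (P.L : ℝ) ^ k * (y₁ μ).val + P.L ^ k + (R₀ + R) ≤ (c (Fin.cast hPd μ) : ℝ) * P.L ^ k + (P.L : ℝ) ^ k * M0 (Fin.cast hPd μ)) →
        ‖deltaLocT (B1RG242Torus.α P a k * (P.L : ℝ) ^ (k * P.d)) P.eps⁻¹ U k
              (cubeFam hPd (P.L ^ k) c M0 sg W) (lamFam hPd (P.L ^ k) c M0 sg) (cutoff R₁ R₀ (B5Ineq137Torus.T P 0)) y₁ y₂ -
            deltaRegion (B1RG242Torus.α P a k * (P.L : ℝ) ^ (k * P.d)) P.eps⁻¹ U k Ω y₁ y₂‖ ≤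
          (B1RG242Torus.α P a k * (P.L : ℝ) ^ (k * P.d)) * (B1.aSeq a P.L k * (c₀ * Real.exp (δ₀ / 2)) *
            (((⌊(((P.L : ℝ) ^ k) - 1 + R₀) / sg⌋₊ : ℝ) + 3) ^ (d + 1) *
              Real.exp (-(δ₀ * (((P.L : ℝ) ^ k)⁻¹ * (2 * R)))) +
                Real.exp (-(δ₀ / 2 * (((P.L : ℝ) ^ k)⁻¹ * R₁)))) *
              Real.exp (-(δ₀ / 2 * B5Ineq137Torus.T P (0 + k) y₁ y₂))) := by
  obtain ⟨δ₀, c₀, hδ₀, hc₀, I⟩ := inputs_smoothNear_region d ℓ hd1 hd3 hℓ hodd ha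
  refine ⟨δ₀, c₀, hδ₀, hc₀, ?_⟩
  intro P hPd hPL k hk1 hkK hbig c M0 hM0 hfit0 hN0 sg W hsg R R₀ R₁ hRm hR₁ hR10 hW hgap Ω hΩ hΩ₀ U θ hθ0 hplaq hτ y₁ y₂ hy₁
  obtain ⟨I1, -, I3⟩ := I P hPd hPL hk1 hkK hbig hM0 hfit0 hN0 sg W Ω hΩ hΩ₀ U hθ0 hplaq hτ
  have hkm : k ≤ P.m + P.K := hkK.trans (Nat.le_add_left _ _)
  have hk : 0 + k ≤ P.m + P.K := by omega
  have hn : 1 ≤ P.L ^ k := Nat.one_le_pow _ _ P.L_pos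
  have hPk : (0 : ℝ) < (P.L : ℝ) ^ k := pow_pos P.cast_L_pos k
  have hR : 0 ≤ R := le_trans (by positivity) hRm.le
  have hR₀ : 0 ≤ R₀ := hR₁.trans hR10.le
  have hζ0 := cutoff_eq_zero_of_le (P := P) hR10
  obtain ⟨hX₀, hcomp, hdeep, hcut, S, hSm, hS⟩ := rows_of_deep hPd hk hn hsg hfit0 hR hR₁ hR10 hRm hgap hW hy₁
  have h := close235_gen hk1 hk ha P.eps⁻¹ U Ω univ (cubeFam hPd (P.L ^ k) c M0 sg W)
    (fun α => deepRows (10 * (P.L : ℝ) ^ k) (cubeFam hPd (P.L ^ k) c M0 sg W α))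
    (lam := lamFam hPd (P.L ^ k) c M0 sg) (ζ'' := cutoff R₁ R₀ (B5Ineq137Torus.T P 0))
    (sum_abs_lamT_le_one hfit0) (cutoff_mem_unitInterval R₁ R₀) hδ₀.le hc₀.le I1 I3 hR y₁ y₂ hX₀ hcomp hdeep hcut S hS
  refine h.trans ?_
  have hak0 : 0 < B1.aSeq a P.L k := B1.aSeq_pos ha (B1RG242Torus.one_lt_cast_L P) hk1
  have hα : 0 < B1RG242Torus.α P a k := mul_pos hak0 (inv_pos.mpr (pow_pos (P.spacing_pos k) 2))
  have hA0 : 0 ≤ B1RG242Torus.α P a k * (P.L : ℝ) ^ (k * P.d) := (mul_pos hα (pow_pos P.cast_L_pos _)).le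
  have hSm' : (S.card : ℝ) ≤ (⌊(((P.L : ℝ) ^ k) - 1 + R₀) / sg⌋₊ + 3) ^ (d + 1) := by exact_mod_cast hSm
  have hE1 := (Real.exp_pos (-(δ₀ * (((P.L : ℝ) ^ k)⁻¹ * (2 * R))))).le
  refine mul_le_mul_of_nonneg_left ?_ hA0
  refine mul_le_mul_of_nonneg_right (mul_le_mul_of_nonneg_left ?_ (by positivity)) (Real.exp_pos _).le
  exact add_le_add (mul_le_mul_of_nonneg_right hSm' hE1) le_rfl

/-- **(2.36) FOR `Δ_{k,loc}(u)` AT A FIELD PLAQUETTE-SMALL NEAR THE REFERENCE BOX `Ω₀` ONLY, FOR THE PRINTED TORUS DATA** (p. 263: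
*"|Δ_{k,loc}(u; x₁, x₂)| ≦ ce^{−|x₁−x₂|}, (2.36)"*, (2.32) *"in a neighborhood of each □_α"*): with the box data of `opClose231_smoothNear_region_cwt`,
for every `U(1)` field with `‖u(∂p) − 1‖ ≤ θ` for the plaquettes based within `2L^k` of `Ω₀`, every `k`-site `y₁` whose block lies in `Ω₀` with chart
margin `R₀ + R` and every `y₂`: `‖Δ_{k,loc}(u; y₁, y₂)‖ ≤ A·(δ_{y₁y₂} + m·a_k·c₀e^{δ₀}·e^{−δ₀|y₁−y₂|_{T^{(k)}}})` — p31's `decay236_gen` BY NAME.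
[cite: BalabanImbrieJaffe1988, (2.36), (2.32) p.263] -/
theorem decay236_smoothNear_cwt (d ℓ : ℕ) (hd1 : 1 ≤ d) (hd3 : d + 1 ≤ 3) (hℓ : 1 ≤ ℓ) (hodd : Odd (ℓ + 1)) {a : ℝ} (ha : 0 < a) :
    ∃ δ₀ c₀ : ℝ, 0 < δ₀ ∧ 0 < c₀ ∧ ∀ (P : Params) (hPd : P.d = d + 1), P.L = ℓ + 1 →
      ∀ (k : ℕ), 1 ≤ k → k ≤ P.K → 2 * (P.L ^ k - 1) + 4 < P.sitesPerDir 0 →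
      ∀ (c M0 : Fin (d + 1) → ℕ), (∀ i, 1 ≤ M0 i) → (∀ i, c i * P.L ^ k + P.L ^ k * M0 i ≤ P.sitesPerDir 0) →
        (∀ i, P.L ^ k * M0 i < P.sitesPerDir 0) →
      ∀ (sg W : ℕ), 1 ≤ sg → ∀ (R R₀ R₁ : ℝ), 10 * (P.L : ℝ) ^ k < R → 0 ≤ R₁ → R₁ < R₀ →
        2 * (sg : ℝ) / 3 + R₀ / 2 + R ≤ W → (∀ i, ((P.L ^ k * M0 i : ℕ) : ℝ) + R ≤ P.sitesPerDir 0) →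
      ∀ (U : GaugeField P 0 U1) (θ : ℝ), 0 ≤ θ →
        (∀ p : Balaban1983to89.Plaq P 0, (∃ y ∈ (cubeT hPd (P.L ^ k) c fun i => P.L ^ k * M0 i), supDist y p.src ≤ 2 * P.L ^ k) →
          ‖toC (plaqHol U p) - 1‖ ≤ θ) →
        (((P.L : ℝ) ^ k) ^ 2 * θ) ^ 2 ≤ 1 / 500 →
      ∀ (y₁ y₂ : Balaban1983to89.Site P (0 + k)),
        (∀ μ, (c (Fin.cast hPd μ) : ℝ) * P.L ^ k + (R₀ + R) ≤ (P.L : ℝ) ^ k * (y₁ μ).val ∧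
          (P.L : ℝ) ^ k * (y₁ μ).val + P.L ^ k + (R₀ + R) ≤ (c (Fin.cast hPd μ) : ℝ) * P.L ^ k + (P.L : ℝ) ^ k * M0 (Fin.cast hPd μ)) →
        ‖deltaLocT (B1RG242Torus.α P a k * (P.L : ℝ) ^ (k * P.d)) P.eps⁻¹ U k
              (cubeFam hPd (P.L ^ k) c M0 sg W) (lamFam hPd (P.L ^ k) c M0 sg) (cutoff R₁ R₀ (B5Ineq137Torus.T P 0)) y₁ y₂‖ ≤
          (B1RG242Torus.α P a k * (P.L : ℝ) ^ (k * P.d)) *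
            ((if y₁ = y₂ then 1 else 0) +
              ((⌊(((P.L : ℝ) ^ k) - 1 + R₀) / sg⌋₊ : ℝ) + 3) ^ (d + 1) * B1.aSeq a P.L k * (c₀ * Real.exp δ₀) *
                Real.exp (-(δ₀ * B5Ineq137Torus.T P (0 + k) y₁ y₂))) := by
  obtain ⟨δ₀, c₀, hδ₀, hc₀, I⟩ := inputs_smoothNear_region d ℓ hd1 hd3 hℓ hodd ha
  refine ⟨δ₀, c₀, hδ₀, hc₀, ?_⟩
  intro P hPd hPL k hk1 hkK hbig c M0 hM0 hfit0 hN0 sg W hsg R R₀ R₁ hRm hR₁ hR10 hW hgap U θ hθ0 hplaq hτ y₁ y₂ hy₁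
  have hkm : k ≤ P.m + P.K := hkK.trans (Nat.le_add_left _ _)
  have hk : 0 + k ≤ P.m + P.K := by omega
  have hΩ₀ : IsBlockUnion k (cubeT hPd (P.L ^ k) c fun i => P.L ^ k * M0 i) := isBlockUnion_cubeT hPd hkm rfl hfit0
  obtain ⟨-, I2, -⟩ := I P hPd hPL hk1 hkK hbig hM0 hfit0 hN0 sg W _ hΩ₀ subset_rfl U hθ0 hplaq hτ
  have hn : 1 ≤ P.L ^ k := Nat.one_le_pow _ _ P.L_pos
  have hPk : (0 : ℝ) < (P.L : ℝ) ^ k := pow_pos P.cast_L_pos k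
  have hR : 0 ≤ R := le_trans (by positivity) hRm.le
  have hR₀ : 0 ≤ R₀ := hR₁.trans hR10.le
  have hζ0 := cutoff_eq_zero_of_le (P := P) hR10
  obtain ⟨-, -, hdeep, -, S, hSm, hS⟩ := rows_of_deep hPd hk hn hsg hfit0 hR hR₁ hR10 hRm hgap hW hy₁
  have h := decay236_gen hk1 hk ha P.eps⁻¹ U (cubeFam hPd (P.L ^ k) c M0 sg W)
    (fun α => deepRows (10 * (P.L : ℝ) ^ k) (cubeFam hPd (P.L ^ k) c M0 sg W α))
    (lam := lamFam hPd (P.L ^ k) c M0 sg) (ζ'' := cutoff R₁ R₀ (B5Ineq137Torus.T P 0))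
    (sum_abs_lamT_le_one hfit0) (abs_cutoff_le_one₂ R₁ R₀) hδ₀.le hc₀.le (fun α x hx => I2 α x (mem_univ x)) y₁ y₂
    (fun x hx α y hne => (hdeep x hx α y hne).1) S hS
  refine h.trans ?_
  have hak0 : 0 < B1.aSeq a P.L k := B1.aSeq_pos ha (B1RG242Torus.one_lt_cast_L P) hk1
  have hα : 0 < B1RG242Torus.α P a k := mul_pos hak0 (inv_pos.mpr (pow_pos (P.spacing_pos k) 2))
  have hA0 : 0 ≤ B1RG242Torus.α P a k * (P.L : ℝ) ^ (k * P.d) := (mul_pos hα (pow_pos P.cast_L_pos _)).le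
  have hSm' : (S.card : ℝ) ≤ (⌊(((P.L : ℝ) ^ k) - 1 + R₀) / sg⌋₊ + 3) ^ (d + 1) := by exact_mod_cast hSm
  refine mul_le_mul_of_nonneg_left (add_le_add le_rfl ?_) hA0
  exact mul_le_mul_of_nonneg_right (mul_le_mul_of_nonneg_right (mul_le_mul_of_nonneg_right hSm' hak0.le) (by positivity))
    (Real.exp_pos _).le

end Members235

/-! ## §4 (2.31)/(2.35) for regions UNDER THE PRINTED (2.32): r18's `SmoothOn` near `Ω` -/

section Smooth

variable {d : ℕ}

/-- **(2.31), OPERATOR FORM, FOR A GENERAL REGION `Ω ⊇ Ω₀` UNDER THE PRINTED (2.32)** (p. 263: *"for (2.31) we assume smoothness throughout the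
subset Ω ⊂ T_η. This means that in a neighborhood of each □_α there exists an A, λ such that u = exp[ie_kη(A + ∂λ)] with |∂A|, |∂*A| ≦ O(p(e_k)).
(2.32)"*): `opClose231_smoothNear_region_cwt` with the plaquette hypothesis DISCHARGED from r18's `SmoothOn e_k η C 𝓅 X B Pl (cfg u)` whenever
`Pl` contains the plaquettes based within `2L^k` of `Ω` and `B` their bonds (p34 gen 20's `plaqSmall_near_of_smoothOn`: `‖u(∂p) − 1‖ ≤ e_kη²C𝓅`
there), at the threshold `(L^{2k}·e_kη²C𝓅)² ≤ 1/500` (`0 ≤ e_k`, `0 ≤ C𝓅`).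
[cite: BalabanImbrieJaffe1988, (2.31)–(2.32) p.263] [cite: BalabanImbrieJaffe1985, p.326] -/
theorem opClose231_smoothOn_region_cwt (d ℓ : ℕ) (hd1 : 1 ≤ d) (hd3 : d + 1 ≤ 3) (hℓ : 1 ≤ ℓ) (hodd : Odd (ℓ + 1)) {a : ℝ} (ha : 0 < a) :
    ∃ δ₀ c₀ : ℝ, 0 < δ₀ ∧ 0 < c₀ ∧ ∀ (P : Params) (hPd : P.d = d + 1), P.L = ℓ + 1 →
      ∀ (k : ℕ), 1 ≤ k → k ≤ P.K → 2 * (P.L ^ k - 1) + 4 < P.sitesPerDir 0 →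
      ∀ (c M0 : Fin (d + 1) → ℕ), (∀ i, 1 ≤ M0 i) → (∀ i, c i * P.L ^ k + P.L ^ k * M0 i ≤ P.sitesPerDir 0) →
        (∀ i, P.L ^ k * M0 i < P.sitesPerDir 0) →
      ∀ (sg W : ℕ), 1 ≤ sg → ∀ (R R₀ R₁ : ℝ), 10 * (P.L : ℝ) ^ k < R → 0 ≤ R₁ → R₁ < R₀ →
        2 * (sg : ℝ) / 3 + R₀ / 2 + R ≤ W → (∀ i, ((P.L ^ k * M0 i : ℕ) : ℝ) + R ≤ P.sitesPerDir 0) →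
      ∀ (Ω : Finset (Balaban1983to89.Site P 0)), IsBlockUnion k Ω → (cubeT hPd (P.L ^ k) c fun i => P.L ^ k * M0 i) ⊆ Ω →
      ∀ (U : GaugeField P 0 U1) (ek η C pek : ℝ), 0 ≤ ek → 0 ≤ C * pek →
      ∀ (X : Finset (Balaban1983to89.Site P 0)) (Bd : Finset (PBond P 0)) (Pl : Finset (Balaban1983to89.Plaq P 0)),
        SmoothOn ek η C pek X Bd Pl (cfg U) →
        (∀ p : Balaban1983to89.Plaq P 0, (∃ y ∈ Ω, supDist y p.src ≤ 2 * P.L ^ k) → p ∈ Pl) →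
        (∀ p ∈ Pl, (⟨p.src, p.μ⟩ : PBond P 0) ∈ Bd ∧ (⟨p.src.shift p.μ, p.ν⟩ : PBond P 0) ∈ Bd ∧
          (⟨p.src.shift p.ν, p.μ⟩ : PBond P 0) ∈ Bd ∧ (⟨p.src, p.ν⟩ : PBond P 0) ∈ Bd) →
        (((P.L : ℝ) ^ k) ^ 2 * (ek * η ^ 2 * (C * pek))) ^ 2 ≤ 1 / 500 →
      ∀ (x : Balaban1983to89.Site P 0), x ∈ (cubeT hPd (P.L ^ k) c fun i => P.L ^ k * M0 i) →
        (∀ i, R₀ + R ≤ (boxCoord hPd (P.L ^ k) c x i : ℝ) ∧ (boxCoord hPd (P.L ^ k) c x i : ℝ) + (R₀ + R) ≤ (P.L ^ k * M0 i : ℕ) - 1) →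
      ∀ (f : Balaban1983to89.Site P 0 → ℂ) (F D : ℝ), (∀ y, ‖f y‖ ≤ F) → 0 ≤ D → (∀ y, f y ≠ 0 → D ≤ B5Ineq137Torus.T P 0 x y) →
        ‖(gLocT (B1RG242Torus.α P a k * (P.L : ℝ) ^ (k * P.d)) P.eps⁻¹ U k
              (cubeFam hPd (P.L ^ k) c M0 sg W) (lamFam hPd (P.L ^ k) c M0 sg) (cutoff R₁ R₀ (B5Ineq137Torus.T P 0)) *ᵥ f) x -
            (gBox (B1RG242Torus.α P a k * (P.L : ℝ) ^ (k * P.d)) P.eps⁻¹ U k Ω *ᵥ f) x‖ ≤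
          P.spacing k ^ 2 * (c₀ * (((⌊(((P.L : ℝ) ^ k) - 1 + R₀) / sg⌋₊ : ℝ) + 3) ^ (d + 1) *
              Real.exp (-(δ₀ * (((P.L : ℝ) ^ k)⁻¹ * (2 * R)))) +
                Real.exp (-(δ₀ / 2 * (((P.L : ℝ) ^ k)⁻¹ * R₁)))) *
            Real.exp (-(δ₀ / 2 * (((P.L : ℝ) ^ k)⁻¹ * D))) * F) := by
  obtain ⟨δ₀, c₀, hδ₀, hc₀, M⟩ := opClose231_smoothNear_region_cwt d ℓ hd1 hd3 hℓ hodd ha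
  refine ⟨δ₀, c₀, hδ₀, hc₀, ?_⟩
  intro P hPd hPL k hk1 hkK hbig c M0 hM0 hfit0 hN0 sg W hsg R R₀ R₁ hRm hR₁ hR10 hW hgap Ω hΩ hΩ₀ U ek η C pek hek hCp X Bd Pl hS hPl hBd
    hτ x hx hdeep f F D hF hD hsupp
  exact M P hPd hPL k hk1 hkK hbig c M0 hM0 hfit0 hN0 sg W hsg R R₀ R₁ hRm hR₁ hR10 hW hgap Ω hΩ hΩ₀ U (ek * η ^ 2 * (C * pek))
    (by positivity) (plaqSmall_near_of_smoothOn hek hS hPl hBd) hτ x hx hdeep f F D hF hD hsupp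

/-- **(2.31), KERNEL FORM, FOR A GENERAL REGION `Ω ⊇ Ω₀` UNDER THE PRINTED (2.32)**: `close231_smoothNear_region_kernel_cwt` with the plaquette
hypothesis discharged from r18's `SmoothOn e_k η C 𝓅 X B Pl (cfg u)` (`Pl ⊇` the plaquettes based within `2L^k` of `Ω`, `B ⊇` their bonds), threshold
`(L^{2k}·e_kη²C𝓅)² ≤ 1/500`. [cite: BalabanImbrieJaffe1988, (2.31)–(2.32) p.263] -/
theorem close231_smoothOn_region_kernel_cwt (d ℓ : ℕ) (hd1 : 1 ≤ d) (hd3 : d + 1 ≤ 3) (hℓ : 1 ≤ ℓ) (hodd : Odd (ℓ + 1)) {a : ℝ}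
    (ha : 0 < a) :
    ∃ δ₀ c₀ : ℝ, 0 < δ₀ ∧ 0 < c₀ ∧ ∀ (P : Params) (hPd : P.d = d + 1), P.L = ℓ + 1 →
      ∀ (k : ℕ), 1 ≤ k → k ≤ P.K → 2 * (P.L ^ k - 1) + 4 < P.sitesPerDir 0 →
      ∀ (c M0 : Fin (d + 1) → ℕ), (∀ i, 1 ≤ M0 i) → (∀ i, c i * P.L ^ k + P.L ^ k * M0 i ≤ P.sitesPerDir 0) →
        (∀ i, P.L ^ k * M0 i < P.sitesPerDir 0) →
      ∀ (sg W : ℕ), 1 ≤ sg → ∀ (R R₀ R₁ : ℝ), 10 * (P.L : ℝ) ^ k < R → 0 ≤ R₁ → R₁ < R₀ →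
        2 * (sg : ℝ) / 3 + R₀ / 2 + R ≤ W → (∀ i, ((P.L ^ k * M0 i : ℕ) : ℝ) + R ≤ P.sitesPerDir 0) →
      ∀ (Ω : Finset (Balaban1983to89.Site P 0)), IsBlockUnion k Ω → (cubeT hPd (P.L ^ k) c fun i => P.L ^ k * M0 i) ⊆ Ω →
      ∀ (U : GaugeField P 0 U1) (ek η C pek : ℝ), 0 ≤ ek → 0 ≤ C * pek →
      ∀ (X : Finset (Balaban1983to89.Site P 0)) (Bd : Finset (PBond P 0)) (Pl : Finset (Balaban1983to89.Plaq P 0)),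
        SmoothOn ek η C pek X Bd Pl (cfg U) →
        (∀ p : Balaban1983to89.Plaq P 0, (∃ y ∈ Ω, supDist y p.src ≤ 2 * P.L ^ k) → p ∈ Pl) →
        (∀ p ∈ Pl, (⟨p.src, p.μ⟩ : PBond P 0) ∈ Bd ∧ (⟨p.src.shift p.μ, p.ν⟩ : PBond P 0) ∈ Bd ∧
          (⟨p.src.shift p.ν, p.μ⟩ : PBond P 0) ∈ Bd ∧ (⟨p.src, p.ν⟩ : PBond P 0) ∈ Bd) →
        (((P.L : ℝ) ^ k) ^ 2 * (ek * η ^ 2 * (C * pek))) ^ 2 ≤ 1 / 500 →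
      ∀ (x : Balaban1983to89.Site P 0), x ∈ (cubeT hPd (P.L ^ k) c fun i => P.L ^ k * M0 i) →
        (∀ i, R₀ + R ≤ (boxCoord hPd (P.L ^ k) c x i : ℝ) ∧ (boxCoord hPd (P.L ^ k) c x i : ℝ) + (R₀ + R) ≤ (P.L ^ k * M0 i : ℕ) - 1) →
      ∀ y : Balaban1983to89.Site P 0,
        ‖gLocT (B1RG242Torus.α P a k * (P.L : ℝ) ^ (k * P.d)) P.eps⁻¹ U k
              (cubeFam hPd (P.L ^ k) c M0 sg W) (lamFam hPd (P.L ^ k) c M0 sg) (cutoff R₁ R₀ (B5Ineq137Torus.T P 0)) x y -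
            gBox (B1RG242Torus.α P a k * (P.L : ℝ) ^ (k * P.d)) P.eps⁻¹ U k Ω x y‖ ≤
          P.spacing k ^ 2 * (c₀ * (Real.exp (-(δ₀ * (((P.L : ℝ) ^ k)⁻¹ * (2 * R)))) +
              Real.exp (-(δ₀ / 2 * (((P.L : ℝ) ^ k)⁻¹ * R₁)))) *
            Real.exp (-(δ₀ / 2 * (((P.L : ℝ) ^ k)⁻¹ * B5Ineq137Torus.T P 0 x y)))) := by
  obtain ⟨δ₀, c₀, hδ₀, hc₀, M⟩ := close231_smoothNear_region_kernel_cwt d ℓ hd1 hd3 hℓ hodd ha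
  refine ⟨δ₀, c₀, hδ₀, hc₀, ?_⟩
  intro P hPd hPL k hk1 hkK hbig c M0 hM0 hfit0 hN0 sg W hsg R R₀ R₁ hRm hR₁ hR10 hW hgap Ω hΩ hΩ₀ U ek η C pek hek hCp X Bd Pl hS hPl hBd
    hτ x hx hdeep y
  exact M P hPd hPL k hk1 hkK hbig c M0 hM0 hfit0 hN0 sg W hsg R R₀ R₁ hRm hR₁ hR10 hW hgap Ω hΩ hΩ₀ U (ek * η ^ 2 * (C * pek))
    (by positivity) (plaqSmall_near_of_smoothOn hek hS hPl hBd) hτ x hx hdeep y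

/-- **(2.35) FOR A GENERAL REGION `Ω ⊇ Ω₀` UNDER THE PRINTED (2.32)**: `close235_smoothNear_region_cwt` with the plaquette hypothesis discharged
from r18's `SmoothOn e_k η C 𝓅 X B Pl (cfg u)` (`Pl ⊇` the plaquettes based within `2L^k` of `Ω`, `B ⊇` their bonds), threshold
`(L^{2k}·e_kη²C𝓅)² ≤ 1/500`. [cite: BalabanImbrieJaffe1988, (2.35), (2.32) p.263] -/
theorem close235_smoothOn_region_cwt (d ℓ : ℕ) (hd1 : 1 ≤ d) (hd3 : d + 1 ≤ 3) (hℓ : 1 ≤ ℓ) (hodd : Odd (ℓ + 1)) {a : ℝ} (ha : 0 < a) :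
    ∃ δ₀ c₀ : ℝ, 0 < δ₀ ∧ 0 < c₀ ∧ ∀ (P : Params) (hPd : P.d = d + 1), P.L = ℓ + 1 →
      ∀ (k : ℕ), 1 ≤ k → k ≤ P.K → 2 * (P.L ^ k - 1) + 4 < P.sitesPerDir 0 →
      ∀ (c M0 : Fin (d + 1) → ℕ), (∀ i, 1 ≤ M0 i) → (∀ i, c i * P.L ^ k + P.L ^ k * M0 i ≤ P.sitesPerDir 0) →
        (∀ i, P.L ^ k * M0 i < P.sitesPerDir 0) →
      ∀ (sg W : ℕ), 1 ≤ sg → ∀ (R R₀ R₁ : ℝ), 10 * (P.L : ℝ) ^ k < R → 0 ≤ R₁ → R₁ < R₀ →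
        2 * (sg : ℝ) / 3 + R₀ / 2 + R ≤ W → (∀ i, ((P.L ^ k * M0 i : ℕ) : ℝ) + R ≤ P.sitesPerDir 0) →
      ∀ (Ω : Finset (Balaban1983to89.Site P 0)), IsBlockUnion k Ω → (cubeT hPd (P.L ^ k) c fun i => P.L ^ k * M0 i) ⊆ Ω →
      ∀ (U : GaugeField P 0 U1) (ek η C pek : ℝ), 0 ≤ ek → 0 ≤ C * pek →
      ∀ (X : Finset (Balaban1983to89.Site P 0)) (Bd : Finset (PBond P 0)) (Pl : Finset (Balaban1983to89.Plaq P 0)),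
        SmoothOn ek η C pek X Bd Pl (cfg U) →
        (∀ p : Balaban1983to89.Plaq P 0, (∃ y ∈ Ω, supDist y p.src ≤ 2 * P.L ^ k) → p ∈ Pl) →
        (∀ p ∈ Pl, (⟨p.src, p.μ⟩ : PBond P 0) ∈ Bd ∧ (⟨p.src.shift p.μ, p.ν⟩ : PBond P 0) ∈ Bd ∧
          (⟨p.src.shift p.ν, p.μ⟩ : PBond P 0) ∈ Bd ∧ (⟨p.src, p.ν⟩ : PBond P 0) ∈ Bd) →
        (((P.L : ℝ) ^ k) ^ 2 * (ek * η ^ 2 * (C * pek))) ^ 2 ≤ 1 / 500 →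
      ∀ (y₁ y₂ : Balaban1983to89.Site P (0 + k)),
        (∀ μ, (c (Fin.cast hPd μ) : ℝ) * P.L ^ k + (R₀ + R) ≤ (P.L : ℝ) ^ k * (y₁ μ).val ∧
          (P.L : ℝ) ^ k * (y₁ μ).val + P.L ^ k + (R₀ + R) ≤ (c (Fin.cast hPd μ) : ℝ) * P.L ^ k + (P.L : ℝ) ^ k * M0 (Fin.cast hPd μ)) →
        ‖deltaLocT (B1RG242Torus.α P a k * (P.L : ℝ) ^ (k * P.d)) P.eps⁻¹ U k
              (cubeFam hPd (P.L ^ k) c M0 sg W) (lamFam hPd (P.L ^ k) c M0 sg) (cutoff R₁ R₀ (B5Ineq137Torus.T P 0)) y₁ y₂ -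
            deltaRegion (B1RG242Torus.α P a k * (P.L : ℝ) ^ (k * P.d)) P.eps⁻¹ U k Ω y₁ y₂‖ ≤
          (B1RG242Torus.α P a k * (P.L : ℝ) ^ (k * P.d)) * (B1.aSeq a P.L k * (c₀ * Real.exp (δ₀ / 2)) *
            (((⌊(((P.L : ℝ) ^ k) - 1 + R₀) / sg⌋₊ : ℝ) + 3) ^ (d + 1) *
              Real.exp (-(δ₀ * (((P.L : ℝ) ^ k)⁻¹ * (2 * R)))) +
                Real.exp (-(δ₀ / 2 * (((P.L : ℝ) ^ k)⁻¹ * R₁)))) *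
              Real.exp (-(δ₀ / 2 * B5Ineq137Torus.T P (0 + k) y₁ y₂))) := by
  obtain ⟨δ₀, c₀, hδ₀, hc₀, M⟩ := close235_smoothNear_region_cwt d ℓ hd1 hd3 hℓ hodd ha
  refine ⟨δ₀, c₀, hδ₀, hc₀, ?_⟩
  intro P hPd hPL k hk1 hkK hbig c M0 hM0 hfit0 hN0 sg W hsg R R₀ R₁ hRm hR₁ hR10 hW hgap Ω hΩ hΩ₀ U ek η C pek hek hCp X Bd Pl hS hPl hBd
    hτ y₁ y₂ hy₁
  exact M P hPd hPL k hk1 hkK hbig c M0 hM0 hfit0 hN0 sg W hsg R R₀ R₁ hRm hR₁ hR10 hW hgap Ω hΩ hΩ₀ U (ek * η ^ 2 * (C * pek))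
    (by positivity) (plaqSmall_near_of_smoothOn hek hS hPl hBd) hτ y₁ y₂ hy₁

end Smooth

/-! ## §5 (v1.1, append-only) Non-vacuity with a field that is NOT plaquette-small away from `Ω` -/

section LocalInstance

open BIJ85CovariantHiggsDictionary (expGauge)
open BIJ88Decay241RegularTorusCwt (plaqC_expGauge norm_plaqC_expGauge_sub_one_le)
open BIJ88NeumannPropagatorFlatDecayCube (mem_cubeT_iff_val)
open BIJ85AbelianStokes (plaqC plaqC_eq_toC_plaqHol)

/-- kernel: two residues `v < 66` and `72 < t` with `t + 6 < N` are at cyclic distance `> 6` on `ℤ/N`. [folklore] -/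
private theorem far_coord {N : ℕ} [NeZero N] {v t : ℕ} (hv : v < 66) (ht1 : 72 < t) (ht2 : t + 6 < N) :
    6 < min (((v : ZMod N) - (t : ZMod N)).val) (((t : ZMod N) - (v : ZMod N)).val) := by
  have hvt : v ≤ t := by omega
  have e1 : ((t : ZMod N) - (v : ZMod N)) = ((t - v : ℕ) : ZMod N) := by rw [Nat.cast_sub hvt]
  have hlt : t - v < N := by omega
  have hval1 : (((t - v : ℕ) : ZMod N)).val = t - v := by rw [ZMod.val_natCast, Nat.mod_eq_of_lt hlt]
  have hne : ((t - v : ℕ) : ZMod N) ≠ 0 := by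
    intro h
    have h' := congrArg ZMod.val h
    rw [hval1, ZMod.val_zero] at h'
    omega
  have e2 : ((v : ZMod N) - (t : ZMod N)) = -(((t - v : ℕ) : ZMod N)) := by rw [← e1]; ring
  have hval2 : (-(((t - v : ℕ) : ZMod N))).val = N - (t - v) := by rw [ZMod.neg_val, if_neg hne, hval1]
  rw [e2, hval2, e1, hval1]
  exact lt_min (by omega) (by omega)

/-- **THE HYPOTHESES OF `opClose231_smoothNear_region_cwt` ARE SATISFIED BY A FIELD THAT IS NOT PLAQUETTE-SMALL — the local hypothesis
(2.32) is strictly weaker than the global one of p31's `BIJ88DeltaLocSmallPlaquetteRegionCwt`**: for every `a > 0` the theorem yields `δ₀, c₀`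
(`d′ = 2`, `L = 3`), and on a torus `(ℤ/2·3^{m+1})²` (`3^m > 100`, `K = 1`), at level `k = 1`, for the `U(1)` field `u = e^{iεeA₀}`, `e = π/ε`,
`A₀` = the indicator of the single bond `⟨(100,100), e₀⟩` — so that `u ≡ 1` off that bond and the plaquette `p₀ = ⟨(100,100), e₀, e₁⟩` has
`u(∂p₀) = e^{iπ} = −1`, `‖u(∂p₀) − 1‖ = 2` (NOT small at any admissible `θ`) —, the reference box `Ω = Ω₀ = [0, 66)²`, spacing `s_g = 1`,
half-width `W = 33`, radii `R = 31`, `R₁ = 0 < R₀ = 1` and the row `x ≡ (32, 32)`: `u` IS plaquette-small with `θ = 0` on every plaquette based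
within `2L^k = 6` of `Ω` (their bonds avoid `(100,100)`), every displayed hypothesis holds, and consequently
`‖(G_{k,loc}(u)f − G_k(Ω,u)f)(x)‖ ≤ (L^kε)²·c₀·(25·e^{−2δ₀R/3} + 1)·‖f‖_∞` for every `f` (`D = 0`).
[cite: BalabanImbrieJaffe1988, (2.31)–(2.32) p.263] -/
theorem opClose231_smoothNear_region_cwt_nonvacuous_local {a : ℝ} (ha : 0 < a) :
    ∃ δ₀ c₀ : ℝ, 0 < δ₀ ∧ 0 < c₀ ∧
    ∃ (P : Params) (hPd : P.d = 1 + 1), P.L = 3 ∧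
    ∃ (U : GaugeField P 0 U1),
      (∃ p₀ : Balaban1983to89.Plaq P 0, ‖toC (plaqHol U p₀) - 1‖ = 2) ∧
      (∀ p : Balaban1983to89.Plaq P 0,
        (∃ y ∈ (cubeT hPd (P.L ^ 1) (fun _ => 0) fun i => P.L ^ 1 * (fun _ => 22 : Fin (1 + 1) → ℕ) i), supDist y p.src ≤ 2 * P.L ^ 1) →
          ‖toC (plaqHol U p) - 1‖ ≤ 0) ∧
    ∃ (x : Balaban1983to89.Site P 0), (∀ μ, (x μ).val = 32) ∧
      ∀ (f : Balaban1983to89.Site P 0 → ℂ) (F : ℝ), (∀ y, ‖f y‖ ≤ F) →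
        ‖(gLocT (B1RG242Torus.α P a 1 * (P.L : ℝ) ^ (1 * P.d)) P.eps⁻¹ U 1
              (cubeFam hPd (P.L ^ 1) (fun _ => 0) (fun _ => 22) 1 33) (lamFam hPd (P.L ^ 1) (fun _ => 0) (fun _ => 22) 1)
              (cutoff 0 1 (B5Ineq137Torus.T P 0)) *ᵥ f) x -
            (gBox (B1RG242Torus.α P a 1 * (P.L : ℝ) ^ (1 * P.d)) P.eps⁻¹ U 1
              (cubeT hPd (P.L ^ 1) (fun _ => 0) fun i => P.L ^ 1 * (fun _ => 22 : Fin (1 + 1) → ℕ) i) *ᵥ f) x‖ ≤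
          P.spacing 1 ^ 2 * (c₀ * (((⌊(((P.L : ℝ) ^ 1) - 1 + 1) / (1 : ℕ)⌋₊ : ℝ) + 3) ^ (1 + 1) *
              Real.exp (-(δ₀ * (((P.L : ℝ) ^ 1)⁻¹ * (2 * 31)))) +
                Real.exp (-(δ₀ / 2 * (((P.L : ℝ) ^ 1)⁻¹ * 0)))) *
            Real.exp (-(δ₀ / 2 * (((P.L : ℝ) ^ 1)⁻¹ * 0))) * F) := by
  obtain ⟨δ₀, c₀, hδ₀, hc₀, M⟩ := opClose231_smoothNear_region_cwt 1 2 le_rfl (by norm_num) (by norm_num) ⟨1, by norm_num⟩ ha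
  refine ⟨δ₀, c₀, hδ₀, hc₀, ?_⟩
  -- the torus: any `m` with `3^m > 100`
  obtain ⟨m, hm⟩ := pow_unbounded_of_one_lt (100 : ℝ) (by norm_num : (1 : ℝ) < 3)
  have hX : 100 < 3 ^ m := by exact_mod_cast hm
  have hm1 : 1 ≤ m := by
    rcases Nat.eq_zero_or_pos m with h | h
    · subst h; norm_num at hX
    · exact h
  set P : Params := ⟨2, 3, m, 1, by norm_num, ⟨⟨1, by norm_num⟩, by norm_num⟩⟩ with hPdef
  have hN0 : P.sitesPerDir 0 = 2 * (3 * 3 ^ m) := by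
    show 2 * 3 ^ (m + 1 - 0) = _
    rw [Nat.sub_zero, pow_succ, mul_comm (3 ^ m) 3]
  have hNbig : 606 ≤ P.sitesPerDir 0 := by rw [hN0]; omega
  have hPd : P.d = 1 + 1 := rfl
  have hε0 : P.eps ≠ 0 := P.eps_pos.ne'
  -- the box data, kept opaque until the end
  obtain ⟨c0, hc0⟩ : ∃ c : Fin (1 + 1) → ℕ, c = fun _ => 0 := ⟨_, rfl⟩
  obtain ⟨M0, hM0⟩ : ∃ M : Fin (1 + 1) → ℕ, M = fun _ => 22 := ⟨_, rfl⟩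
  obtain ⟨v, hv⟩ : ∃ n : ℕ, n = 32 := ⟨_, rfl⟩
  have hvN : v < P.sitesPerDir 0 := by rw [hN0]; omega
  set x : Balaban1983to89.Site P 0 := fun _ => ((v : ℕ) : ZMod (P.sitesPerDir 0)) with hx
  have hxv : ∀ μ : Fin P.d, (x μ).val = v := by
    intro μ
    show ZMod.val ((v : ℕ) : ZMod (P.sitesPerDir 0)) = v
    rw [ZMod.val_natCast, Nat.mod_eq_of_lt hvN]
  have hfit0 : ∀ i : Fin (1 + 1), c0 i * P.L ^ 1 + P.L ^ 1 * M0 i ≤ P.sitesPerDir 0 := by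
    intro i; rw [hc0, hM0, hN0]; show 0 * 3 ^ 1 + 3 ^ 1 * 22 ≤ 2 * (3 * 3 ^ m); omega
  have hxmem : x ∈ cubeT hPd (P.L ^ 1) c0 (fun i => P.L ^ 1 * M0 i) := by
    rw [mem_cubeT_iff_val hPd hfit0]
    intro μ
    rw [hxv μ, hc0, hM0]
    show 0 * 3 ^ 1 ≤ v ∧ v < 0 * 3 ^ 1 + 3 ^ 1 * 22
    omega
  have hΩ : IsBlockUnion 1 (cubeT hPd (P.L ^ 1) c0 fun i => P.L ^ 1 * M0 i) :=
    isBlockUnion_cubeT hPd (by show 1 ≤ m + 1; omega) rfl hfit0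
  have hdeep : ∀ i : Fin (1 + 1), (1 : ℝ) + 31 ≤ (boxCoord hPd (P.L ^ 1) c0 x i : ℝ) ∧
      (boxCoord hPd (P.L ^ 1) c0 x i : ℝ) + (1 + 31) ≤ (P.L ^ 1 * M0 i : ℕ) - 1 := by
    intro i
    have hb : (boxCoord hPd (P.L ^ 1) c0 x i : ℝ) = v := by
      unfold boxCoord
      rw [hxv (Fin.cast hPd.symm i), hc0]
      beta_reduce
      push_cast
      ring
    rw [hb, hv, hM0]
    show (1 : ℝ) + 31 ≤ ((32 : ℕ) : ℝ) ∧ ((32 : ℕ) : ℝ) + (1 + 31) ≤ ((3 ^ 1 * 22 : ℕ) : ℝ) - 1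
    norm_num
  -- the defect: the bond `⟨z₀, e₀⟩`, `z₀ ≡ (100, 100)`, carries `A₀ = 1` (phase `π`); every other bond carries `0`
  set i0 : Fin P.d := ⟨0, by rw [hPd]; norm_num⟩ with hi0
  set i1 : Fin P.d := ⟨1, by rw [hPd]; norm_num⟩ with hi1
  have h01 : i0 < i1 := by rw [hi0, hi1, Fin.mk_lt_mk]; exact zero_lt_one
  have hi10 : i1 ≠ i0 := ne_of_gt h01
  obtain ⟨z₀, hz₀⟩ : ∃ z : Balaban1983to89.Site P 0, z = fun _ => ((100 : ℕ) : ZMod (P.sitesPerDir 0)) := ⟨_, rfl⟩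
  have hz₀i : ∀ κ : Fin P.d, z₀ κ = ((100 : ℕ) : ZMod (P.sitesPerDir 0)) := fun κ => by rw [hz₀]
  obtain ⟨A₀, hA₀⟩ : ∃ A : PBond P 0 → ℝ, A = fun b => if b.src = z₀ ∧ b.dir = i0 then 1 else 0 := ⟨_, rfl⟩
  have hA₀_off : ∀ b : PBond P 0, b.src ≠ z₀ → A₀ b = 0 := fun b hb => by
    rw [hA₀]; dsimp only; exact if_neg fun h => hb h.1
  have hA₀_dir : ∀ b : PBond P 0, b.dir ≠ i0 → A₀ b = 0 := fun b hb => by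
    rw [hA₀]; dsimp only; exact if_neg fun h => hb h.2
  have hA₀_on : A₀ ⟨z₀, i0⟩ = 1 := by rw [hA₀]; dsimp only; exact if_pos ⟨rfl, rfl⟩
  obtain ⟨U, hU⟩ : ∃ U : GaugeField P 0 U1, U = expGauge P (Real.pi / P.eps) A₀ := ⟨_, rfl⟩
  -- (a) the defect plaquette `p₀ = ⟨z₀, e₀, e₁⟩`: `u(∂p₀) = e^{iπ} = −1`
  have hz₀1 : z₀.shift i1 ≠ z₀ := by
    intro h
    have h1 := congrFun h i1
    simp only [Balaban1983to89.Site.shift, Function.update_self] at h1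
    haveI : Fact (1 < P.sitesPerDir 0) := ⟨by omega⟩
    exact one_ne_zero (add_eq_left.1 h1)
  have hdefect : ‖toC (plaqHol U ⟨z₀, i0, i1, h01⟩) - 1‖ = 2 := by
    rw [← plaqC_eq_toC_plaqHol U z₀ h01, hU, plaqC_expGauge, hA₀_on, hA₀_dir ⟨z₀.shift i0, i1⟩ hi10,
      hA₀_off ⟨z₀.shift i1, i0⟩ hz₀1, hA₀_dir ⟨z₀, i1⟩ hi10,
      show P.eps * (Real.pi / P.eps) * (1 + 0 - 0 - 0) = Real.pi by
        rw [show (1 : ℝ) + 0 - 0 - 0 = 1 by norm_num, mul_one, mul_div_assoc', mul_div_cancel_left₀ _ hε0], Complex.exp_pi_mul_I]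
    norm_num
  -- (b) plaquettes based within `2L^k = 6` of `Ω = [0,66)²` avoid `z₀`: their three source sites have first coordinate of cyclic distance
  --     `≤ 7` from `[0, 66)`, whereas `z₀`'s is `100`
  have hfar : ∀ (w y : Balaban1983to89.Site P 0), w ∈ cubeT hPd (P.L ^ 1) c0 (fun i => P.L ^ 1 * M0 i) →
      supDist w y ≤ 2 * P.L ^ 1 → y i0 ≠ z₀ i0 ∧ y i0 + 1 ≠ z₀ i0 := by
    intro w y hw hd
    have hv66 : (w i0).val < 66 := by
      have h := (((mem_cubeT_iff_val hPd hfit0 w).1 hw) i0).2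
      rw [hc0, hM0] at h
      simp only [zero_mul, zero_add] at h
      exact h.trans_le (by show 3 ^ 1 * 22 ≤ 66; norm_num)
    have hmin : min (w i0 - y i0).val (y i0 - w i0).val ≤ 6 := by
      have h1 : min (w i0 - y i0).val (y i0 - w i0).val ≤ supDist w y := by
        unfold supDist
        exact Finset.le_sup (f := fun μ : Fin P.d => min (w μ - y μ).val (y μ - w μ).val) (Finset.mem_univ i0)
      have h2 : 2 * P.L ^ 1 ≤ 6 := by show 2 * 3 ^ 1 ≤ 6; norm_num
      omega
    have hwcast : w i0 = (((w i0).val : ℕ) : ZMod (P.sitesPerDir 0)) := (ZMod.natCast_zmod_val _).symm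
    rw [hz₀i]
    constructor
    · intro h
      rw [h, hwcast] at hmin
      have h3 := far_coord (N := P.sitesPerDir 0) hv66 (show 72 < 100 by norm_num) (by omega)
      omega
    · intro h
      have hy : y i0 = ((99 : ℕ) : ZMod (P.sitesPerDir 0)) := by
        have h' : y i0 + 1 = ((99 : ℕ) : ZMod (P.sitesPerDir 0)) + 1 := by rw [h]; push_cast; norm_num
        exact add_right_cancel h'
      rw [hy, hwcast] at hmin
      have h3 := far_coord (N := P.sitesPerDir 0) hv66 (show 72 < 99 by norm_num) (by omega)
      omega
  have hθ : ∀ p : Balaban1983to89.Plaq P 0, (∃ y ∈ cubeT hPd (P.L ^ 1) c0 (fun i => P.L ^ 1 * M0 i), supDist y p.src ≤ 2 * P.L ^ 1) →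
      ‖toC (plaqHol U p) - 1‖ ≤ 0 := by
    rintro ⟨y, μ, ν, hμν⟩ ⟨w, hw, hd⟩
    obtain ⟨hy0, hy1⟩ := hfar w y hw hd
    have hyz : y ≠ z₀ := fun h => hy0 (congrFun h i0)
    have hsz : ∀ κ : Fin P.d, y.shift κ ≠ z₀ := by
      intro κ h
      have h1 := congrFun h i0
      by_cases hκ : i0 = κ
      · subst hκ
        simp only [Balaban1983to89.Site.shift, Function.update_self] at h1
        exact hy1 h1
      · simp only [Balaban1983to89.Site.shift, Function.update_of_ne hκ] at h1
        exact hy0 h1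
    rw [← plaqC_eq_toC_plaqHol U y hμν, hU]
    refine (norm_plaqC_expGauge_sub_one_le (Real.pi / P.eps) A₀ y μ ν).trans (le_of_eq ?_)
    rw [hA₀_off ⟨y, μ⟩ hyz, hA₀_off ⟨y.shift μ, ν⟩ (hsz μ), hA₀_off ⟨y.shift ν, μ⟩ (hsz ν), hA₀_off ⟨y, ν⟩ hyz]
    norm_num
  have hθθ : (((P.L : ℝ) ^ 1) ^ 2 * 0) ^ 2 ≤ 1 / 500 := by norm_num
  refine ⟨P, hPd, rfl, U, ⟨⟨z₀, i0, i1, h01⟩, hdefect⟩, ?_, x, fun μ => (hxv μ).trans hv, fun f F hF => ?_⟩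
  · subst hc0 hM0
    exact hθ
  · have h := M P hPd rfl 1 le_rfl le_rfl (by rw [hN0]; show 2 * (3 ^ 1 - 1) + 4 < 2 * (3 * 3 ^ m); omega) c0 M0
      (fun _ => by rw [hM0]; norm_num) hfit0 (fun i => by rw [hM0, hN0]; show 3 ^ 1 * 22 < 2 * (3 * 3 ^ m); omega)
      1 33 le_rfl 31 1 0 (by show 10 * (3 : ℝ) ^ 1 < 31; norm_num) le_rfl one_pos (by push_cast; norm_num)
      (fun i => by
        rw [hM0, hN0]; show (((3 ^ 1 * 22 : ℕ)) : ℝ) + 31 ≤ ((2 * (3 * 3 ^ m) : ℕ) : ℝ)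
        have hXr : (100 : ℝ) < (3 : ℝ) ^ m := hm
        push_cast; linarith)
      _ hΩ subset_rfl U 0 le_rfl hθ hθθ x hxmem hdeep f F 0 hF le_rfl (fun y _ => B5Ineq137Torus.T_nonneg P 0 x y)
    subst hc0 hM0
    simpa using h

end LocalInstance

end

end Literature.MathematicalPhysics.QuantumFieldTheory.BalabanImbrieJaffe1984to88.BIJ88DeltaLocSmoothNearRegionCwt
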